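import Mathlib.Analysis.Real.Pi.Leibniz
import Literature.NumberTheory.Irrationality.Zudilin2003.CatalanRecursion
import Literature.NumberTheory.Irrationality.CressonFischlerRivoal2008.WellPoisedSymmetry
import HarnessLib

/-!
# Zudilin 2003, Sect. 2: the very-well-poised series `F_n` for Catalan's constant — Lemmas 1–5 and the
# limit `v_n/u_n → G` of Theorem 1

Source: W. Zudilin, *An Apéry-like difference equation for Catalan's constant*, Electron. J. Combin.
**10** (2003), #R14, arXiv:math/0201024 [Zudilin2003Catalan], Sect. 2.

HONEST FRAMING (cell `pub-zeta5`): systematic search; no irrationality claim unless certified. This file is our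
formalisation of the PUBLISHED proof of the limit clause of [Zudilin2003Catalan, Theorem 1]
(`lim v_n/u_n = G`); the companion file `CatalanRecursion.lean` types the objects (`R`, `s`, `sNum`, `p`, `q`,
`u`, `v`, `form`, `IsSolution`) and proves the algebraic content of Lemma 2 (`lemma2_cleared`). We follow the
printed architecture step by step:

* **Lemma 1** (eqs. (15)–(19), (9)): `R_n(t'+½) = Q_n(t')/((t'+1)_{n+1})³` with an explicit `Q_n ∈ ℚ[X]` of degree
  `2n+1` (`numPoly`, `R_half_shift`), hence THE partial-fraction data `pf n` of `R_n` (eq. (17); existence by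
  `CressonFischlerRivoal2008.exists_partialFractions`, uniqueness `BallRivoal.pf_unique`), the alternating
  coefficient sums `coefAlt n o = ∑_k (-1)^k A_{2-o,k}(n)` of (18) (`U_n = 8·coefAlt n 2`, `U_n' = 4·coefAlt n 1`,
  `U_n'' = 2·coefAlt n 0`), `V n` of (19), and `F_n := ∑_{t≥0} (-1)^t R_n(t) = U_n β(3) + U_n' β(2) + U_n'' β(1) - V_n`
  (`lemma1`, `F_eq`). The summation is a generic tool (`hasSum_alt_pfEval`: the `β`-analogue of the depth-1
  summation `CressonFischlerRivoal2008.hasSum_partialFractions`): for partial-fraction data `c` in the sense of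
  `BallRivoal.pfEval` with `∑_p c_{0,p} = 0`, `∑_{k≥0} (-1)^k·pfEval c (k-½) = ∑_o (∑_p (-1)^p c_{o,p}) B_{o+1}
  - ∑_{o,p} c_{o,p} (-1)^p Hβ_p^{(o+1)}` with `B_s = ∑_{m≥0} (-1)^m/(m+½)^s = 2^s β(s)` (`B_1 = π/2`, Leibniz) and
  `Hβ_p^{(s)} = ∑_{m<p} (-1)^m/(m+½)^s`; the order-one part converges only conditionally. `β(2) = G` is the tree's
  `catalanConstant` (`beta_two`).
* **Lemma 2 ⇒ (21)**: the ratios `R_{n+1}/R_n`, `R_n(t+1)/R_n(t)` (`R_succ_mul`, `R_shift_mul`) turn the cleared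
  identity `lemma2_cleared` back into (21) at every half-integer `t = k+½` (`identity21_half`), where no
  denominator of the printed verification vanishes.
* **Lemma 4**: the certificate `S_n = s_n R_n` has partial-fraction data too (`sHat`, `pfS`; for `n = 1` the factor
  `t+1` of `sNum_1` is divided out explicitly, `sRed`); (21) holds at the level of DATA (`comb_eq_zero`, by
  uniqueness from the vanishing at all `k+½`) — hence also at the naturals (`identity21_nat`) — and the data of
  `S_n(t+1) + S_n(t)` have vanishing alternating coefficient sums (`sum_shiftData`): this is the "multiply (21) by
  `(-1)^k (t+k+½)^3`, differentiate, put `t = -k-½`, sum over all `k`" of the source. So `n ↦ coefAlt n o` solves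
  (2) (`coefAlt_isSolution`).
* Initial values from `R_0 = 2/(t+½)²`, `R_1` (display before Lemma 5; `tab0`, `tab1`): `U_n = U_n'' = 0`,
  `U_n' = 8u_n` (`U_values`), `V_0 = 0`, `V_1 = 13`.
* **Lemma 3**: `F_n` solves (2) (`F_rec`): sum (21) against `(-1)^t`; the right side telescopes, `S_n(0) = 0` and
  `S_n(N) → 0` (`tendsto_S`, from `|s_n(N)| = O(N)` and `R_n(N) = O(N^{-2})`).
* **Lemma 5**: `V_n` solves (2) (`V_isSolution`), `V_n = 8v_n` (`V_eq`), `F_n = U_n'G - V_n = 8(u_n G - v_n)`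
  (`F_eq_form`, `hasSum_form`).
* **Theorem 1, limit clause** (`tendsto_v_div_u`): `v_n/u_n → G`. The source takes `F_n → 0` (and `F_n ≠ 0`) from
  the Beukers-type integral of its Theorem 3; the limit clause only needs `F_n/u_n → 0`, which we get from the
  elementary bound `0 ≤ R_n(N) ≤ 2^{n+1}/(N+½)²` (`R_nat_bounds`, hence `|F_n| ≤ 2^{n+1}∑_N (N+½)^{-2}`,
  `abs_F_le`) against `u_{n+1} ≥ 5u_n` (`u_succ_ge`, from `q(n) ≥ 5(2n+1)²(2n+2)²p(n)`).

NOT here: the arithmetic half of Lemma 1 / the inclusions (5) of Theorem 1 (`2^{4n}D_n^j A_{jk} ∈ ℤ`, from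
[Zu2, Lemma 7]), `F_n ≠ 0`, Theorems 2–5 of the source. With this file the named fact `Zudilin2003.theorem1`
is reduced to its integrality clause, and the cited rates `Zudilin2003.rates` follow in the cell's Summit files
(`Zeta5Search/Zudilin2003ExactDecay`: `rates_of_theorem1` needs only positivity, proved in `CatalanRecursion`,
and this limit).
-/
noncomputable section

open Finset Filter Polynomial
open scoped _root_.Topology

namespace Literature.NumberTheory.Irrationality.Zudilin2003

open Literature.NumberTheory.Transcendental
open Literature.NumberTheory.Transcendental.BallRivoal hiding poch
open Literature.NumberTheory.Irrationality.CressonFischlerRivoal2008 (exists_partialFractions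
  partialFractions_sum_order_zero)

/-! ### Alternating sums over half-integers of partial-fraction data -/

/-- `Hβ_p^{(s)} := ∑_{m<p} (-1)^m/(m+½)^s`, the finite alternating sums entering `V_n` in (19) (printed there as
`2^{3-j} ∑_{l<k} (-1)^l/(2l+1)^{3-j}`). [cite: Zudilin2003Catalan, Sect. 2, eq. (19)] -/
def harmAlt (s p : ℕ) : ℚ := ∑ m ∈ range p, (-1) ^ m / ((m : ℚ) + 1 / 2) ^ s

/-- `B_s := ∑_{m≥0} (-1)^m/(m+½)^s = 2^s β(s)` for `s ≥ 2` (absolutely convergent) and `B_1 := π/2 = 2β(1)` (the value of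
Leibniz's conditionally convergent series). [cite: Zudilin2003Catalan, Sect. 1–2 (β(s); eq. (9))] -/
def betaSum (s : ℕ) : ℝ :=
  if s = 1 then Real.pi / 2 else ∑' m : ℕ, (-1) ^ m / ((m : ℝ) + 1 / 2) ^ s

/-- `B_1 = π/2`. [cite: Zudilin2003Catalan, Sect. 2, eq. (9) (β(1) = π/4)] -/
theorem betaSum_one : betaSum 1 = Real.pi / 2 := by simp [betaSum]

/-- For `s ≥ 2` the series `∑ (-1)^m/(m+½)^s` is absolutely convergent (compare with `2^s/(m+1)^s`). [folklore] -/
private theorem summable_alt_half (s : ℕ) (hs : 2 ≤ s) :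
    Summable (fun m : ℕ => (-1 : ℝ) ^ m / ((m : ℝ) + 1 / 2) ^ s) := by
  have hg : Summable (fun m : ℕ => (2 : ℝ) ^ s * (1 / ((m : ℝ) + 1) ^ s)) := by
    have h2 : Summable (fun m : ℕ => 1 / (m : ℝ) ^ s) :=
      Real.summable_one_div_nat_pow.mpr (by omega)
    have := (summable_nat_add_iff 1).mpr h2
    simp only [Nat.cast_add, Nat.cast_one] at this
    exact this.mul_left _
  refine Summable.of_norm_bounded hg ?_
  intro m
  have hm : (0 : ℝ) < (m : ℝ) + 1 / 2 := by positivity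
  rw [norm_div, norm_pow, norm_neg, norm_one, one_pow, norm_pow, Real.norm_eq_abs, abs_of_pos hm]
  have h1 : 1 * ((m : ℝ) + 1) ^ s ≤ (2 : ℝ) ^ s * ((m : ℝ) + 1 / 2) ^ s := by
    rw [one_mul, ← mul_pow]
    exact pow_le_pow_left₀ (by positivity) (by linarith) s
  rw [mul_one_div, div_le_div_iff₀ (by positivity) (by positivity)]
  exact h1

/-- `∑_{k≥0} (-1)^k/(k+p+½)^s = (-1)^p (B_s - Hβ_p^{(s)})` for `s ≥ 2` (shift of the absolutely convergent series).
[cite: Zudilin2003Catalan, Sect. 2, proof of Lemma 1 (display after (17))] -/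
theorem hasSum_alt_half_shift (s p : ℕ) (hs : 2 ≤ s) :
    HasSum (fun k : ℕ => (-1 : ℝ) ^ k / ((k : ℝ) + p + 1 / 2) ^ s)
      ((-1) ^ p * (betaSum s - (harmAlt s p : ℝ))) := by
  set f : ℕ → ℝ := fun m => (-1 : ℝ) ^ m / ((m : ℝ) + 1 / 2) ^ s with hfdef
  have hf : HasSum f (betaSum s) := by
    rw [betaSum, if_neg (by omega)]
    exact (summable_alt_half s hs).hasSum
  have hshift := (hasSum_nat_add_iff' p).mpr hf
  have hfin : ∑ i ∈ range p, f i = (harmAlt s p : ℝ) := by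
    simp only [hfdef, harmAlt]
    push_cast
    rfl
  rw [hfin] at hshift
  have hfun : (fun k : ℕ => (-1 : ℝ) ^ k / ((k : ℝ) + p + 1 / 2) ^ s) =
      fun k : ℕ => (-1 : ℝ) ^ p * f (k + p) := by
    funext k
    simp only [hfdef, pow_add, Nat.cast_add]
    have h1 : ((-1 : ℝ) ^ p) * (-1) ^ p = 1 := by
      rw [← pow_add, ← two_mul, pow_mul]
      norm_num
    calc (-1 : ℝ) ^ k / ((k : ℝ) + p + 1 / 2) ^ s
        = ((-1 : ℝ) ^ p * (-1) ^ p) * (-1) ^ k / ((k : ℝ) + p + 1 / 2) ^ s := by rw [h1, one_mul]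
      _ = (-1) ^ p * ((-1) ^ k * (-1) ^ p / ((k : ℝ) + p + 1 / 2) ^ s) := by ring
  rw [hfun]
  exact hshift.mul_left _

/-- Leibniz: `∑_{m<M} (-1)^m/(m+½) → π/2` (Mathlib `Real.tendsto_sum_pi_div_four`, doubled). [folklore] -/
private theorem tendsto_harmAlt_one :
    Tendsto (fun M : ℕ => ∑ m ∈ range M, (-1 : ℝ) ^ m / ((m : ℝ) + 1 / 2)) atTop (𝓝 (Real.pi / 2)) := by
  have h := Real.tendsto_sum_pi_div_four.const_mul 2
  rw [show (2 : ℝ) * (Real.pi / 4) = Real.pi / 2 by ring] at h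
  refine h.congr fun M => ?_
  rw [mul_sum]
  refine sum_congr rfl fun m _ => ?_
  have : (2 : ℝ) * m + 1 ≠ 0 := by positivity
  have : (m : ℝ) + 1 / 2 ≠ 0 := by positivity
  field_simp

/-- Partial sums of the shifted Leibniz series: `∑_{k<N} (-1)^k/(k+p+½) = (-1)^p (T_{N+p} - T_p)` with
`T_M = ∑_{m<M} (-1)^m/(m+½)`. [folklore] -/
private theorem sum_range_alt_shift (p N : ℕ) :
    ∑ k ∈ range N, (-1 : ℝ) ^ k / ((k : ℝ) + p + 1 / 2) =
      (-1) ^ p * (∑ m ∈ range (N + p), (-1 : ℝ) ^ m / ((m : ℝ) + 1 / 2) -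
        ∑ m ∈ range p, (-1 : ℝ) ^ m / ((m : ℝ) + 1 / 2)) := by
  induction N with
  | zero => simp
  | succ N ih =>
    rw [sum_range_succ, ih, show N + 1 + p = N + p + 1 by ring, sum_range_succ]
    have : ((-1 : ℝ) ^ p) * (-1) ^ (N + p) = (-1) ^ N := by
      rw [← pow_add, show p + (N + p) = N + 2 * p by ring, pow_add, pow_mul]
      norm_num
    push_cast
    linear_combination -(this / ((N : ℝ) + p + 1 / 2))

/-- **Alternating summation of a partial-fraction expansion over the half-integers** (the computation (17)–(19) of
the proof of Lemma 1, for arbitrary data): if `c` are partial-fraction data with `∑_p c_{0,p} = 0`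
(poles `-p-1`, `p ≤ n`; orders `o+1 ≤ A`, as in `BallRivoal.pfEval`), then
`∑_{k≥0} (-1)^k · pfEval c (k-½) = ∑_{o<A} (∑_p (-1)^p c_{o,p}) B_{o+1} - ∑_{o<A} ∑_p c_{o,p} (-1)^p Hβ_p^{(o+1)}`,
`B_s = betaSum s = 2^s β(s)`, `Hβ = harmAlt`. The order-one part converges only conditionally term by term; the sum is
absolutely convergent because `∑_p c_{0,p} = 0`. [cite: Zudilin2003Catalan, Sect. 2, proof of Lemma 1 (eqs. (17)–(19))] -/
theorem hasSum_alt_pfEval (n A : ℕ) (hA : 1 ≤ A) (c : ℕ → ℕ → ℚ)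
    (hz : ∑ p ∈ range (n + 1), c 0 p = 0) :
    HasSum (fun k : ℕ => (-1 : ℝ) ^ k * (pfEval n A c ((k : ℚ) - 1 / 2) : ℝ))
      (∑ o ∈ range A, (∑ p ∈ range (n + 1), (-1 : ℝ) ^ p * (c o p : ℝ)) * betaSum (o + 1) -
        ∑ o ∈ range A, ∑ p ∈ range (n + 1), (c o p : ℝ) * (-1) ^ p * (harmAlt (o + 1) p : ℝ)) := by
  -- pointwise expansion of the summand
  have hexp : ∀ k : ℕ, (-1 : ℝ) ^ k * (pfEval n A c ((k : ℚ) - 1 / 2) : ℝ) =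
      ∑ o ∈ Ico 1 A, ∑ p ∈ range (n + 1), (c o p : ℝ) * ((-1 : ℝ) ^ k / ((k : ℝ) + p + 1 / 2) ^ (o + 1)) +
        ∑ p ∈ range (n + 1), (c 0 p : ℝ) * ((-1 : ℝ) ^ k / ((k : ℝ) + p + 1 / 2)) := by
    intro k
    rw [pfEval, sum_comm, range_eq_Ico A, sum_eq_sum_Ico_succ_bot hA, add_comm]
    push_cast
    rw [mul_add, mul_sum, mul_sum]
    congr 1
    · refine sum_congr rfl fun o _ => ?_
      rw [mul_sum]
      refine sum_congr rfl fun p _ => ?_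
      rw [show (k : ℝ) - 1 / 2 + p + 1 = (k : ℝ) + p + 1 / 2 by ring]
      ring
    · refine sum_congr rfl fun p _ => ?_
      rw [pow_one, show (k : ℝ) - 1 / 2 + p + 1 = (k : ℝ) + p + 1 / 2 by ring]
      ring
  -- orders ≥ 2: absolutely convergent, summed term by term
  have hI : HasSum (fun k : ℕ => ∑ o ∈ Ico 1 A, ∑ p ∈ range (n + 1),
      (c o p : ℝ) * ((-1 : ℝ) ^ k / ((k : ℝ) + p + 1 / 2) ^ (o + 1)))
      (∑ o ∈ Ico 1 A, ∑ p ∈ range (n + 1),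
        (c o p : ℝ) * ((-1) ^ p * (betaSum (o + 1) - (harmAlt (o + 1) p : ℝ)))) := by
    refine hasSum_sum fun o ho => hasSum_sum fun p _ => ?_
    have ho' : 2 ≤ o + 1 := by have := (mem_Ico.1 ho).1; omega
    exact (hasSum_alt_half_shift (o + 1) p ho').mul_left _
  -- order 1: conditionally convergent pieces; the combination is absolutely convergent since `∑_p c_{0,p} = 0`
  set g : ℕ → ℝ := fun k => ∑ p ∈ range (n + 1), (c 0 p : ℝ) * ((-1 : ℝ) ^ k / ((k : ℝ) + p + 1 / 2))
    with hgdef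
  have hz' : ∑ p ∈ range (n + 1), (c 0 p : ℝ) = 0 := by exact_mod_cast hz
  have hg_alt : ∀ k : ℕ, g k = ∑ p ∈ range (n + 1),
      (c 0 p : ℝ) * ((-1 : ℝ) ^ k / ((k : ℝ) + p + 1 / 2) - (-1 : ℝ) ^ k / ((k : ℝ) + 1 / 2)) := by
    intro k
    have h0 : ∑ p ∈ range (n + 1), (c 0 p : ℝ) * ((-1 : ℝ) ^ k / ((k : ℝ) + 1 / 2)) = 0 := by
      rw [← sum_mul, hz', zero_mul]
    rw [hgdef]
    simp only [mul_sub, sum_sub_distrib, h0, sub_zero]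
  have hg_summ : Summable g := by
    set K : ℝ := ∑ p ∈ range (n + 1), |(c 0 p : ℝ)| * (4 * p) with hK
    have hbound : Summable (fun k : ℕ => K * (1 / ((k : ℝ) + 1) ^ 2)) := by
      have h2 : Summable (fun m : ℕ => 1 / (m : ℝ) ^ 2) :=
        Real.summable_one_div_nat_pow.mpr one_lt_two
      have := (summable_nat_add_iff 1).mpr h2
      simp only [Nat.cast_add, Nat.cast_one] at this
      exact this.mul_left _
    refine Summable.of_norm_bounded hbound ?_
    intro k
    rw [hg_alt k, Real.norm_eq_abs, hK, sum_mul]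
    refine (abs_sum_le_sum_abs _ _).trans (sum_le_sum fun p _ => ?_)
    have hk : (0 : ℝ) < (k : ℝ) + 1 / 2 := by positivity
    have hkp : (0 : ℝ) < (k : ℝ) + p + 1 / 2 := by positivity
    have hdiff : (-1 : ℝ) ^ k / ((k : ℝ) + p + 1 / 2) - (-1 : ℝ) ^ k / ((k : ℝ) + 1 / 2) =
        (-1 : ℝ) ^ k * (-(p : ℝ) / (((k : ℝ) + p + 1 / 2) * ((k : ℝ) + 1 / 2))) := by
      field_simp
      ring
    rw [abs_mul, hdiff, abs_mul, abs_pow, abs_neg, abs_one, one_pow, one_mul, abs_div, abs_neg,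
      Nat.abs_cast, abs_of_pos (mul_pos hkp hk)]
    have hp0 : (0 : ℝ) ≤ p := Nat.cast_nonneg p
    have h1 : (p : ℝ) / (((k : ℝ) + p + 1 / 2) * ((k : ℝ) + 1 / 2)) ≤ 4 * p * (1 / ((k : ℝ) + 1) ^ 2) := by
      rw [div_le_iff₀ (mul_pos hkp hk)]
      have h3 : ((k : ℝ) + 1) ^ 2 ≤ 4 * (((k : ℝ) + p + 1 / 2) * ((k : ℝ) + 1 / 2)) := by nlinarith
      calc (p : ℝ) = 4 * p * (1 / ((k : ℝ) + 1) ^ 2) * (((k : ℝ) + 1) ^ 2 / 4) := by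
            field_simp
        _ ≤ 4 * p * (1 / ((k : ℝ) + 1) ^ 2) * (((k : ℝ) + p + 1 / 2) * ((k : ℝ) + 1 / 2)) := by
            gcongr
            linarith
    calc |(c 0 p : ℝ)| * ((p : ℝ) / (((k : ℝ) + p + 1 / 2) * ((k : ℝ) + 1 / 2)))
        ≤ |(c 0 p : ℝ)| * (4 * p * (1 / ((k : ℝ) + 1) ^ 2)) := by gcongr
      _ = |(c 0 p : ℝ)| * (4 * p) * (1 / ((k : ℝ) + 1) ^ 2) := by ring
  have hg_tendsto : Tendsto (fun N : ℕ => ∑ k ∈ range N, g k) atTop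
      (𝓝 (∑ p ∈ range (n + 1), (c 0 p : ℝ) * ((-1) ^ p * (betaSum 1 - (harmAlt 1 p : ℝ))))) := by
    have hT : ∀ p : ℕ, Tendsto (fun N : ℕ => ∑ m ∈ range (N + p), (-1 : ℝ) ^ m / ((m : ℝ) + 1 / 2))
        atTop (𝓝 (Real.pi / 2)) := fun p =>
      tendsto_harmAlt_one.comp (tendsto_add_atTop_nat p)
    have hpart : ∀ N : ℕ, ∑ k ∈ range N, g k = ∑ p ∈ range (n + 1), (c 0 p : ℝ) *
        ((-1) ^ p * (∑ m ∈ range (N + p), (-1 : ℝ) ^ m / ((m : ℝ) + 1 / 2) -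
          ∑ m ∈ range p, (-1 : ℝ) ^ m / ((m : ℝ) + 1 / 2))) := by
      intro N
      rw [hgdef, sum_comm]
      refine sum_congr rfl fun p _ => ?_
      rw [← mul_sum, sum_range_alt_shift p N]
    simp_rw [hpart]
    refine tendsto_finsetSum _ fun p _ => Tendsto.const_mul _ (Tendsto.const_mul _ (Tendsto.sub (hT p) ?_))
    have : (harmAlt 1 p : ℝ) = ∑ m ∈ range p, (-1 : ℝ) ^ m / ((m : ℝ) + 1 / 2) := by
      simp only [harmAlt, pow_one]
      push_cast
      rfl
    rw [this]
    exact tendsto_const_nhds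
  have hII : HasSum g (∑ p ∈ range (n + 1), (c 0 p : ℝ) * ((-1) ^ p * (betaSum 1 - (harmAlt 1 p : ℝ)))) :=
    (hg_summ.hasSum_iff_tendsto_nat).mpr hg_tendsto
  have hAB := hI.add hII
  rw [show (fun k : ℕ => (-1 : ℝ) ^ k * (pfEval n A c ((k : ℚ) - 1 / 2) : ℝ)) = fun k : ℕ =>
      ∑ o ∈ Ico 1 A, ∑ p ∈ range (n + 1), (c o p : ℝ) * ((-1 : ℝ) ^ k / ((k : ℝ) + p + 1 / 2) ^ (o + 1)) + g k
      from funext hexp]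
  have hval : ∀ o : ℕ, ∑ p ∈ range (n + 1), (c o p : ℝ) * ((-1) ^ p * (betaSum (o + 1) - (harmAlt (o + 1) p : ℝ))) =
      (∑ p ∈ range (n + 1), (-1 : ℝ) ^ p * (c o p : ℝ)) * betaSum (o + 1) -
        ∑ p ∈ range (n + 1), (c o p : ℝ) * (-1) ^ p * (harmAlt (o + 1) p : ℝ) := by
    intro o
    rw [sum_mul, ← sum_sub_distrib]
    exact sum_congr rfl fun p _ => by ring
  convert hAB using 1
  rw [← sum_sub_distrib, range_eq_Ico A, sum_eq_sum_Ico_succ_bot hA, add_comm]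
  congr 1
  · exact sum_congr rfl fun o _ => (hval o).symm
  · have h0 := hval 0
    simp only [zero_add] at h0
    exact h0.symm

/-! ### `R_n` at the shifted variable: `R_n(t+½) = Q_n(t)/((t+1)_{n+1})³` -/

/-- The numerator of `R_n` in the shifted variable `t = t' - ½`:
`Q_n(t) = n!·(2t+n+2)·∏_{j<n}(t+½-j)·∏_{s<n}(t+n+3/2+s)`, a polynomial of degree `2n+1`.
[cite: Zudilin2003Catalan, Sect. 2, eq. (7)] -/
def numPoly (n : ℕ) : ℚ[X] :=
  C (n.factorial : ℚ) * (C 2 * X + C ((n : ℚ) + 2)) *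
    ((∏ j ∈ range n, (X + C (1 / 2 - (j : ℚ)))) * pochPoly ((n : ℚ) + 3 / 2) n)

/-- Evaluation of `Q_n`. [cite: Zudilin2003Catalan, Sect. 2, eq. (7)] -/
theorem eval_numPoly (n : ℕ) (t : ℚ) :
    (numPoly n).eval t = (n.factorial : ℚ) * (2 * t + ((n : ℚ) + 2)) *
      ((∏ j ∈ range n, (t + (1 / 2 - (j : ℚ)))) * BallRivoal.poch (t + ((n : ℚ) + 3 / 2)) n) := by
  simp only [numPoly, eval_mul, eval_C, eval_add, eval_X, eval_prod, eval_pochPoly]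

/-- `deg (X+β)_n ≤ n`. [folklore] -/
private theorem natDegree_pochPoly_le (β : ℚ) (n : ℕ) : (pochPoly β n).natDegree ≤ n := by
  unfold pochPoly
  refine (natDegree_prod_le _ _).trans ?_
  refine (sum_le_sum fun s _ => (natDegree_X_add_C _).le).trans ?_
  simp

/-- `deg Q_n ≤ 2n+1`. [cite: Zudilin2003Catalan, Sect. 2, eq. (7)] -/
theorem natDegree_numPoly_le (n : ℕ) : (numPoly n).natDegree ≤ 2 * n + 1 := by
  unfold numPoly
  refine natDegree_mul_le.trans ?_
  have h1 : (C (n.factorial : ℚ) * (C 2 * X + C ((n : ℚ) + 2))).natDegree ≤ 1 := by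
    refine natDegree_mul_le.trans ?_
    rw [natDegree_C, zero_add]
    exact natDegree_linear_le
  have h2 : ((∏ j ∈ range n, (X + C (1 / 2 - (j : ℚ)))) * pochPoly ((n : ℚ) + 3 / 2) n).natDegree ≤
      n + n := by
    refine natDegree_mul_le.trans (add_le_add ?_ (natDegree_pochPoly_le _ _))
    refine (natDegree_prod_le _ _).trans ?_
    refine (sum_le_sum fun j _ => (natDegree_X_add_C _).le).trans ?_
    simp
  omega

/-- `deg Q_n < 3(n+1)` (the partial-fraction expansion has no polynomial part).
[cite: Zudilin2003Catalan, Sect. 2, eq. (17)] -/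
theorem degree_numPoly_lt (n : ℕ) : (numPoly n).degree < ((3 * (n + 1) : ℕ) : WithBot ℕ) := by
  have h1 : (numPoly n).degree ≤ ((2 * n + 1 : ℕ) : WithBot ℕ) :=
    degree_le_of_natDegree_le (natDegree_numPoly_le n)
  have h2 : ((2 * n + 1 : ℕ) : WithBot ℕ) < ((3 * (n + 1) : ℕ) : WithBot ℕ) := by
    exact_mod_cast (show 2 * n + 1 < 3 * (n + 1) by omega)
  exact h1.trans_lt h2

/-- **`R_n` in the shifted variable**: `R_n(t+½) = Q_n(t)/((t+1)_{n+1})³`, i.e. the poles `t' = -k-½` of (7) become the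
integer poles `t = -k-1` of `BallRivoal.pfEval`. [cite: Zudilin2003Catalan, Sect. 2, eq. (7)] -/
theorem R_half_shift (n : ℕ) (t : ℚ) :
    R n (t + 1 / 2) = (numPoly n).eval t / BallRivoal.poch (t + 1) (n + 1) ^ 3 := by
  rw [R, eval_numPoly, BallRivoal.poch, BallRivoal.poch]
  have e1 : ∏ j ∈ range n, (t + 1 / 2 - (j : ℚ)) = ∏ j ∈ range n, (t + (1 / 2 - (j : ℚ))) :=
    prod_congr rfl fun j _ => by ring
  have e2 : ∏ j ∈ range n, (t + 1 / 2 + (n : ℚ) + 1 + j) = ∏ s ∈ range n, (t + ((n : ℚ) + 3 / 2) + s) :=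
    prod_congr rfl fun j _ => by ring
  have e3 : ∏ j ∈ range (n + 1), (t + 1 / 2 + (j : ℚ) + 1 / 2) = ∏ s ∈ range (n + 1), (t + 1 + s) :=
    prod_congr rfl fun j _ => by ring
  rw [e1, e2, e3]
  ring

/-! ### The partial-fraction data of `R_n` (17) and the coefficients (18), (19) -/

/-- `R_n(t+½)` has partial-fraction data (orders `≤ 3`, poles `t = -p-1`, `p ≤ n`).
[cite: Zudilin2003Catalan, Sect. 2, eq. (17)] -/
theorem exists_pf (n : ℕ) : ∃ c : ℕ → ℕ → ℚ, ∀ t : ℚ, (∀ p, p ≤ n → t + p + 1 ≠ 0) →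
    pfEval n 3 c t = R n (t + 1 / 2) := by
  obtain ⟨c, hc⟩ := exists_partialFractions n 3 (by norm_num) (numPoly n) (degree_numPoly_lt n)
  exact ⟨c, fun t ht => by rw [hc t ht, R_half_shift]⟩

/-- THE partial-fraction data of `R_n`: `pf n o p = A_{2-o,p}(n)`, the coefficient of `(t'+p+½)^{-(o+1)}` in (17)
(chosen by `exists_pf`; unique by `BallRivoal.pf_unique`, see `pf_eq_of_eval`). [cite: Zudilin2003Catalan, Sect. 2, eqs. (15), (17)] -/
def pf (n : ℕ) : ℕ → ℕ → ℚ := (exists_pf n).choose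

/-- Defining property of `pf n`: `∑_{p≤n} ∑_{o<3} pf n o p/(t+p+1)^{o+1} = R_n(t+½)` away from the poles.
[cite: Zudilin2003Catalan, Sect. 2, eq. (17)] -/
theorem pf_spec (n : ℕ) (t : ℚ) (ht : ∀ p, p ≤ n → t + p + 1 ≠ 0) :
    pfEval n 3 (pf n) t = R n (t + 1 / 2) :=
  (exists_pf n).choose_spec t ht

/-- At the naturals: `pfEval (pf n) k = R_n(k+½)`. [cite: Zudilin2003Catalan, Sect. 2, eq. (17)] -/
theorem pf_spec_nat (n k : ℕ) : pfEval n 3 (pf n) (k : ℚ) = R n ((k : ℚ) + 1 / 2) :=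
  pf_spec n k fun p _ => by positivity

/-- Uniqueness: any data evaluating to `R_n(k+½)` at all naturals `k` IS `pf n` (on the support).
[cite: Zudilin2003Catalan, Sect. 2, eq. (17)] -/
theorem pf_eq_of_eval (n : ℕ) (c : ℕ → ℕ → ℚ) (hc : ∀ k : ℕ, pfEval n 3 c (k : ℚ) = R n ((k : ℚ) + 1 / 2))
    (o p : ℕ) (ho : o < 3) (hp : p ≤ n) : c o p = pf n o p := by
  have h := pf_unique n 3 (fun o p => c o p - pf n o p) 0 (fun t _ => by
    rw [pfEval_sub', hc t, pf_spec_nat, sub_self]) o p ho hp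
  exact sub_eq_zero.1 h

/-- The polar part at infinity vanishes: `∑_p pf n 0 p = 0` (`deg Q_n = 2n+1 ≤ 3(n+1) - 2`).
[cite: Zudilin2003Catalan, Sect. 2, eq. (17)] -/
theorem pf_sum_order_zero (n : ℕ) : ∑ p ∈ range (n + 1), pf n 0 p = 0 :=
  partialFractions_sum_order_zero n 3 (by norm_num) (numPoly n)
    (by have := natDegree_numPoly_le n; omega) (pf n) fun t ht => by rw [pf_spec n t ht, R_half_shift]

/-- The alternating coefficient sums `∑_{k≤n} (-1)^k A_{2-o,k}(n)` of (18) (`o+1` = pole order):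
`U_n = 8·coefAlt n 2`, `U_n' = 4·coefAlt n 1`, `U_n'' = 2·coefAlt n 0`. [cite: Zudilin2003Catalan, Sect. 2, eq. (18)] -/
def coefAlt (n o : ℕ) : ℚ := ∑ p ∈ range (n + 1), (-1) ^ p * pf n o p

/-- `U_n = 2³ ∑_k (-1)^k A_{0k}(n)` (coefficient of `β(3)`). [cite: Zudilin2003Catalan, Sect. 2, eq. (18)] -/
def U3 (n : ℕ) : ℚ := 8 * coefAlt n 2

/-- `U_n' = 2² ∑_k (-1)^k A_{1k}(n)` (coefficient of `β(2) = G`). [cite: Zudilin2003Catalan, Sect. 2, eq. (18)] -/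
def U2 (n : ℕ) : ℚ := 4 * coefAlt n 1

/-- `U_n'' = 2 ∑_k (-1)^k A_{2k}(n)` (coefficient of `β(1)`). [cite: Zudilin2003Catalan, Sect. 2, eq. (18)] -/
def U1 (n : ℕ) : ℚ := 2 * coefAlt n 0

/-- `V_n = ∑_{j=0}^{2} 2^{3-j} ∑_k (-1)^k A_{jk}(n) ∑_{l<k} (-1)^l/(2l+1)^{3-j}` of (19) (here with
`2^{s}/(2l+1)^{s} = 1/(l+½)^{s}`). [cite: Zudilin2003Catalan, Sect. 2, eq. (19)] -/
def V (n : ℕ) : ℚ := ∑ o ∈ range 3, ∑ p ∈ range (n + 1), pf n o p * (-1) ^ p * harmAlt (o + 1) p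

/-- Dirichlet's beta values in the normalisation of the source: `β(s) = B_s/2^s` (`β(2) = G`, `β(1) = π/4`).
[cite: Zudilin2003Catalan, Sect. 1 (β(s))] -/
def beta (s : ℕ) : ℝ := betaSum s / 2 ^ s

/-- `β(1) = π/4`. [cite: Zudilin2003Catalan, Sect. 1 (β(s))] -/
theorem beta_one : beta 1 = Real.pi / 4 := by
  rw [beta, betaSum_one]
  ring

/-- `β(2) = G` (Catalan's constant of the tree, `catalanConstant = ∑ (-1)^n/(2n+1)²`).
[cite: Zudilin2003Catalan, Sect. 1 (G = β(2))] -/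
theorem beta_two : beta 2 = catalanConstant := by
  have h4 : HasSum (fun m : ℕ => (-1 : ℝ) ^ m / ((m : ℝ) + 1 / 2) ^ 2) (4 * catalanConstant) := by
    have h := hasSum_catalanConstant.mul_left 4
    refine h.congr_fun fun m => ?_
    have : (2 : ℝ) * m + 1 ≠ 0 := by positivity
    have : (m : ℝ) + 1 / 2 ≠ 0 := by positivity
    field_simp
    ring
  rw [beta, betaSum, if_neg (by norm_num), h4.tsum_eq]
  ring

/-- `F_n := ∑_{t≥0} (-1)^t R_n(t)`, the very-well-poised series (8). [cite: Zudilin2003Catalan, Sect. 2, eq. (8)] -/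
def F (n : ℕ) : ℝ := ∑' t : ℕ, (-1 : ℝ) ^ t * (R n t : ℝ)

/-- **Lemma 1, summation form**: `∑_t (-1)^t R_n(t) = ∑_{o<3} coefAlt n o · B_{o+1} - V_n` as a `HasSum`.
[cite: Zudilin2003Catalan, Sect. 2, Lemma 1 (eqs. (17)–(19))] -/
theorem hasSum_F (n : ℕ) :
    HasSum (fun t : ℕ => (-1 : ℝ) ^ t * (R n t : ℝ))
      (∑ o ∈ range 3, (coefAlt n o : ℝ) * betaSum (o + 1) - (V n : ℝ)) := by
  have h := hasSum_alt_pfEval n 3 (by norm_num) (pf n) (pf_sum_order_zero n)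
  have hfun : (fun k : ℕ => (-1 : ℝ) ^ k * (pfEval n 3 (pf n) ((k : ℚ) - 1 / 2) : ℝ)) =
      fun t : ℕ => (-1 : ℝ) ^ t * (R n t : ℝ) := by
    funext k
    rw [pf_spec n _ (fun p _ => by
      have : (0 : ℚ) < (k : ℚ) - 1 / 2 + p + 1 := by
        have := (Nat.cast_nonneg k : (0 : ℚ) ≤ k); have := (Nat.cast_nonneg p : (0 : ℚ) ≤ p); linarith
      exact this.ne'), sub_add_cancel]
  rw [hfun] at h
  convert h using 2
  · push_cast [coefAlt]
    rfl
  · push_cast [V]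
    rfl

/-- **Lemma 1** (as printed): `F_n = U_n β(3) + U_n' β(2) + U_n'' β(1) - V_n`.
[cite: Zudilin2003Catalan, Sect. 2, Lemma 1, eq. (9)] -/
theorem lemma1 (n : ℕ) :
    HasSum (fun t : ℕ => (-1 : ℝ) ^ t * (R n t : ℝ))
      ((U3 n : ℝ) * beta 3 + (U2 n : ℝ) * beta 2 + (U1 n : ℝ) * beta 1 - (V n : ℝ)) := by
  convert hasSum_F n using 2
  simp only [U3, U2, U1, beta, sum_range_succ, sum_range_zero]
  push_cast
  ring

/-- `F_n = U_n β(3) + U_n' β(2) + U_n'' β(1) - V_n` for the `tsum` (9). [cite: Zudilin2003Catalan, Sect. 2, Lemma 1, eq. (9)] -/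
theorem F_eq (n : ℕ) :
    F n = (U3 n : ℝ) * beta 3 + (U2 n : ℝ) * beta 2 + (U1 n : ℝ) * beta 1 - (V n : ℝ) :=
  (lemma1 n).tsum_eq

/-! ### The building blocks of `R_n` and their shifts -/

/-- `∏_{j<n} (t-j)`. [folklore] -/
private def fa (n : ℕ) (t : ℚ) : ℚ := ∏ j ∈ range n, (t - j)

/-- `∏_{j<n} (t+n+1+j)`. [folklore] -/
private def fb (n : ℕ) (t : ℚ) : ℚ := ∏ j ∈ range n, (t + n + 1 + j)

/-- `∏_{j≤n} (t+j+½)`. [folklore] -/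
private def fd (n : ℕ) (t : ℚ) : ℚ := ∏ j ∈ range (n + 1), (t + j + 1 / 2)

/-- `R_n` in terms of the blocks. [cite: Zudilin2003Catalan, Sect. 2, eq. (7)] -/
private theorem R_eq' (n : ℕ) (t : ℚ) :
    R n t = (n.factorial : ℚ) * (2 * t + n + 1) * fa n t * fb n t / fd n t ^ 3 := by
  simp only [R, fa, fb, fd]

/-- `∏_{j<n+1}(t-j) = (∏_{j<n}(t-j))(t-n)`. [folklore] -/
private theorem fa_succ (n : ℕ) (t : ℚ) : fa (n + 1) t = fa n t * (t - n) := by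
  rw [fa, prod_range_succ, fa]

/-- `(∏_{j<n+1}(t+n+2+j))(t+n+1) = (∏_{j<n}(t+n+1+j))(t+2n+1)(t+2n+2)`. [folklore] -/
private theorem fb_succ (n : ℕ) (t : ℚ) :
    fb (n + 1) t * (t + n + 1) = fb n t * (t + 2 * n + 1) * (t + 2 * n + 2) := by
  have h1 : ∏ j ∈ range (n + 2), (t + n + 1 + j) = fb n t * (t + 2 * n + 1) * (t + 2 * n + 2) := by
    rw [fb, prod_range_succ, prod_range_succ]
    push_cast
    ring
  have h2 : ∏ j ∈ range (n + 2), (t + n + 1 + j) = fb (n + 1) t * (t + n + 1) := by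
    rw [prod_range_succ', fb]
    congr 1
    · exact prod_congr rfl fun j _ => by push_cast; ring
    · push_cast; ring
  rw [← h2, h1]

/-- `∏_{j≤n+1}(t+j+½) = (∏_{j≤n}(t+j+½))(t+n+3/2)`. [folklore] -/
private theorem fd_succ (n : ℕ) (t : ℚ) : fd (n + 1) t = fd n t * (t + n + 3 / 2) := by
  rw [fd, prod_range_succ, fd]
  push_cast
  ring

/-- `(∏_{j<n}(t+1-j))(t+1-n) = (t+1)∏_{j<n}(t-j)`. [folklore] -/
private theorem fa_shift (n : ℕ) (t : ℚ) : fa n (t + 1) * (t + 1 - n) = (t + 1) * fa n t := by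
  have h1 : fa (n + 1) (t + 1) = fa n (t + 1) * (t + 1 - n) := fa_succ n (t + 1)
  have h2 : fa (n + 1) (t + 1) = (t + 1) * fa n t := by
    rw [fa, prod_range_succ', fa, mul_comm]
    congr 1
    · push_cast; ring
    · exact prod_congr rfl fun j _ => by push_cast; ring
  rw [← h1, h2]

/-- `(∏_{j<n}(t+n+2+j))(t+n+1) = (∏_{j<n}(t+n+1+j))(t+2n+1)`. [folklore] -/
private theorem fb_shift (n : ℕ) (t : ℚ) : fb n (t + 1) * (t + n + 1) = fb n t * (t + 2 * n + 1) := by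
  have h1 : ∏ j ∈ range (n + 1), (t + n + 1 + j) = fb n t * (t + 2 * n + 1) := by
    rw [fb, prod_range_succ]
    ring
  have h2 : ∏ j ∈ range (n + 1), (t + n + 1 + j) = fb n (t + 1) * (t + n + 1) := by
    rw [prod_range_succ', fb]
    congr 1
    · exact prod_congr rfl fun j _ => by push_cast; ring
    · push_cast; ring
  rw [← h2, h1]

/-- `(∏_{j≤n}(t+j+3/2))(t+½) = (∏_{j≤n}(t+j+½))(t+n+3/2)`. [folklore] -/
private theorem fd_shift (n : ℕ) (t : ℚ) : fd n (t + 1) * (t + 1 / 2) = fd n t * (t + n + 3 / 2) := by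
  have h1 : ∏ j ∈ range (n + 2), (t + j + 1 / 2) = fd n t * (t + n + 3 / 2) := by
    rw [fd, prod_range_succ]
    push_cast
    ring
  have h2 : ∏ j ∈ range (n + 2), (t + j + 1 / 2) = fd n (t + 1) * (t + 1 / 2) := by
    rw [prod_range_succ', fd]
    congr 1
    · exact prod_congr rfl fun j _ => by push_cast; ring
    · push_cast; ring
  rw [← h2, h1]

/-- `R_{n+1}(t)/R_n(t)` (the first ratio in the printed proof of Lemma 2), multiplied out.
[cite: Zudilin2003Catalan, Sect. 2, proof of Lemma 2] -/
theorem R_succ_mul (n : ℕ) (t : ℚ) (hd : ∏ j ∈ range (n + 1), (t + j + 1 / 2) ≠ 0)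
    (h1 : t + n + 3 / 2 ≠ 0) :
    R (n + 1) t * ((2 * t + n + 1) * (t + n + 1) * (t + n + 3 / 2) ^ 3) =
      R n t * ((n + 1) * (2 * t + n + 2) * (t - n) * (t + 2 * n + 1) * (t + 2 * n + 2)) := by
  have hd' : fd n t ≠ 0 := hd
  have hD : fd n t ^ 3 ≠ 0 := pow_ne_zero 3 hd'
  have hD1 : (fd n t * (t + n + 3 / 2)) ^ 3 ≠ 0 := pow_ne_zero 3 (mul_ne_zero hd' h1)
  have hb := fb_succ n t
  rw [R_eq', R_eq', fa_succ, fd_succ, Nat.factorial_succ, div_mul_eq_mul_div, div_mul_eq_mul_div,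
    div_eq_div_iff hD1 hD]
  push_cast
  linear_combination ((n : ℚ) + 1) * (n.factorial : ℚ) * (2 * t + n + 2) * fa n t * (t - n) *
    (2 * t + n + 1) * (t + n + 3 / 2) ^ 3 * fd n t ^ 3 * hb

/-- `R_n(t+1)/R_n(t)` (the ratio entering `S_n(t+1)/R_n(t)` in the printed proof of Lemma 2), multiplied out.
[cite: Zudilin2003Catalan, Sect. 2, proof of Lemma 2] -/
theorem R_shift_mul (n : ℕ) (t : ℚ) (hd : ∏ j ∈ range (n + 1), (t + j + 1 / 2) ≠ 0)
    (h4 : t + n + 3 / 2 ≠ 0) :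
    R n (t + 1) * ((2 * t + n + 1) * (t - n + 1) * (t + n + 1) * (t + n + 3 / 2) ^ 3) =
      R n t * ((2 * t + n + 3) * (t + 1 / 2) ^ 3 * (t + 1) * (t + 2 * n + 1)) := by
  have hd' : fd n t ≠ 0 := hd
  have hD : fd n t ^ 3 ≠ 0 := pow_ne_zero 3 hd'
  have e1 := fa_shift n t
  have e2 := fb_shift n t
  have e3 : fd n (t + 1) ^ 3 * (t + 1 / 2) ^ 3 = fd n t ^ 3 * (t + n + 3 / 2) ^ 3 := by
    rw [← mul_pow, fd_shift, mul_pow]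
  have hD' : fd n (t + 1) ^ 3 ≠ 0 := by
    intro h0
    rw [h0, zero_mul] at e3
    exact mul_ne_zero hD (pow_ne_zero 3 h4) e3.symm
  rw [R_eq', R_eq', div_mul_eq_mul_div, div_mul_eq_mul_div, div_eq_div_iff hD' hD]
  calc (n.factorial : ℚ) * (2 * (t + 1) + n + 1) * fa n (t + 1) * fb n (t + 1) *
        ((2 * t + n + 1) * (t - n + 1) * (t + n + 1) * (t + n + 3 / 2) ^ 3) * fd n t ^ 3
      = (n.factorial : ℚ) * (2 * t + n + 3) * (2 * t + n + 1) * (t + n + 3 / 2) ^ 3 * fd n t ^ 3 *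
          (fa n (t + 1) * (t + 1 - n)) * (fb n (t + 1) * (t + n + 1)) := by ring
    _ = (n.factorial : ℚ) * (2 * t + n + 3) * (2 * t + n + 1) * (t + n + 3 / 2) ^ 3 * fd n t ^ 3 *
          ((t + 1) * fa n t) * (fb n t * (t + 2 * n + 1)) := by rw [e1, e2]
    _ = (n.factorial : ℚ) * (2 * t + n + 1) * fa n t * fb n t *
          ((2 * t + n + 3) * (t + 1) * (t + 2 * n + 1)) * (fd n t ^ 3 * (t + n + 3 / 2) ^ 3) := by ring
    _ = (n.factorial : ℚ) * (2 * t + n + 1) * fa n t * fb n t *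
          ((2 * t + n + 3) * (t + 1) * (t + 2 * n + 1)) * (fd n (t + 1) ^ 3 * (t + 1 / 2) ^ 3) := by
          rw [e3]
    _ = _ := by ring

/-! ### Lemma 2 divided back: the identity (21) -/

/-- The identity displayed in the printed proof of Lemma 2 ((21) divided by `R_n(t)`), recovered from its cleared
form `lemma2_cleared` wherever the cleared denominators do not vanish; written with `n = m+1`.
[cite: Zudilin2003Catalan, Sect. 2, Lemma 2 (proof)] -/
private theorem div21 (m t : ℚ)
    (hA : (2 * t + (m + 1) + 1) * (t + (m + 1) + 1) * (t + (m + 1) + 3 / 2) ^ 3 ≠ 0)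
    (hB : (m + 1) * (2 * t + m + 2) * (t - m) * (t + 2 * m + 1) * (t + 2 * m + 2) ≠ 0)
    (hC : (2 * t + (m + 1) + 1) * (t - (m + 1) + 1) * (t + (m + 1) + 1) * (t + (m + 1) + 3 / 2) ^ 3 ≠ 0)
    (hS1 : 2 * (2 * (t + 1) + (m + 1) + 1) * (t + 1 + 2 * (m + 1) - 1) * (t + 1 + 2 * (m + 1)) ≠ 0)
    (hS0 : 2 * (2 * t + (m + 1) + 1) * (t + 2 * (m + 1) - 1) * (t + 2 * (m + 1)) ≠ 0)
    (hM : 8 * (m + 1) * (2 * t + (m + 1) + 1) * (t + (m + 1) + 1) * (2 * t + 2 * (m + 1) + 3) ^ 3 *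
      (t - (m + 1) + 1) * (t + 2 * (m + 1) - 1) * (t + 2 * (m + 1)) ≠ 0) :
    (2 * (m + 1) + 1) ^ 2 * (2 * (m + 1) + 2) ^ 2 * p (m + 1) *
        (((m + 1 + 1) * (2 * t + (m + 1) + 2) * (t - (m + 1)) * (t + 2 * (m + 1) + 1) * (t + 2 * (m + 1) + 2)) /
          ((2 * t + (m + 1) + 1) * (t + (m + 1) + 1) * (t + (m + 1) + 3 / 2) ^ 3))
      - q (m + 1)
      - (2 * (m + 1) - 1) ^ 2 * (2 * (m + 1)) ^ 2 * p (m + 1 + 1) *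
        (((2 * t + m + 1) * (t + m + 1) * (t + m + 3 / 2) ^ 3) /
          ((m + 1) * (2 * t + m + 2) * (t - m) * (t + 2 * m + 1) * (t + 2 * m + 2)))
      + s (m + 1) (t + 1) *
        (((2 * t + (m + 1) + 3) * (t + 1 / 2) ^ 3 * (t + 1) * (t + 2 * (m + 1) + 1)) /
          ((2 * t + (m + 1) + 1) * (t - (m + 1) + 1) * (t + (m + 1) + 1) * (t + (m + 1) + 3 / 2) ^ 3))
      + s (m + 1) t = 0 := by
  set M : ℚ := 8 * (m + 1) * (2 * t + (m + 1) + 1) * (t + (m + 1) + 1) * (2 * t + 2 * (m + 1) + 3) ^ 3 *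
      (t - (m + 1) + 1) * (t + 2 * (m + 1) - 1) * (t + 2 * (m + 1)) with hMdef
  -- the five cleared terms of `lemma2_cleared (m+1) t`
  have hT1 : (2 * (m + 1) + 1) ^ 2 * (2 * (m + 1) + 2) ^ 2 * p (m + 1) *
        (((m + 1 + 1) * (2 * t + (m + 1) + 2) * (t - (m + 1)) * (t + 2 * (m + 1) + 1) * (t + 2 * (m + 1) + 2)) /
          ((2 * t + (m + 1) + 1) * (t + (m + 1) + 1) * (t + (m + 1) + 3 / 2) ^ 3)) * M =
      64 * ((2 * (m + 1) + 1) ^ 2 * (2 * (m + 1) + 2) ^ 2 * p (m + 1)) * (m + 1) * (m + 1 + 1)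
        * ((2 * t + (m + 1) + 2) * (t - (m + 1)) * (t + 2 * (m + 1) + 1) * (t + 2 * (m + 1) + 2))
        * ((t - (m + 1) + 1) * (t + 2 * (m + 1) - 1) * (t + 2 * (m + 1))) := by
    rw [mul_div_assoc', div_mul_eq_mul_div, div_eq_iff hA, hMdef]
    ring
  have hT3 : (2 * (m + 1) - 1) ^ 2 * (2 * (m + 1)) ^ 2 * p (m + 1 + 1) *
        (((2 * t + m + 1) * (t + m + 1) * (t + m + 3 / 2) ^ 3) /
          ((m + 1) * (2 * t + m + 2) * (t - m) * (t + 2 * m + 1) * (t + 2 * m + 2))) * M =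
      ((2 * (m + 1) - 1) ^ 2 * (2 * (m + 1)) ^ 2 * p (m + 1 + 1))
        * ((2 * t + (m + 1)) * (t + (m + 1)) * (2 * t + 2 * (m + 1) + 1) ^ 3)
        * ((t + (m + 1) + 1) * (2 * t + 2 * (m + 1) + 3) ^ 3) := by
    rw [mul_div_assoc', div_mul_eq_mul_div, div_eq_iff hB, hMdef]
    ring
  have hT4 : s (m + 1) (t + 1) *
        (((2 * t + (m + 1) + 3) * (t + 1 / 2) ^ 3 * (t + 1) * (t + 2 * (m + 1) + 1)) /
          ((2 * t + (m + 1) + 1) * (t - (m + 1) + 1) * (t + (m + 1) + 1) * (t + (m + 1) + 3 / 2) ^ 3)) * M =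
      4 * (m + 1) * sNum (m + 1) (t + 1) * (2 * t + 1) ^ 3 * (t + 1) * (t + 2 * (m + 1) - 1) := by
    simp only [s]
    rw [div_mul_div_comm, div_mul_eq_mul_div, div_eq_iff (mul_ne_zero hS1 hC), hMdef]
    ring
  have hT5 : s (m + 1) t * M =
      4 * (m + 1) * sNum (m + 1) t * (t + (m + 1) + 1) * (2 * t + 2 * (m + 1) + 3) ^ 3 * (t - (m + 1) + 1) := by
    simp only [s]
    rw [div_mul_eq_mul_div, div_eq_iff hS0, hMdef]
    ring
  have hcl := lemma2_cleared (m + 1) t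
  have key : ((2 * (m + 1) + 1) ^ 2 * (2 * (m + 1) + 2) ^ 2 * p (m + 1) *
        (((m + 1 + 1) * (2 * t + (m + 1) + 2) * (t - (m + 1)) * (t + 2 * (m + 1) + 1) * (t + 2 * (m + 1) + 2)) /
          ((2 * t + (m + 1) + 1) * (t + (m + 1) + 1) * (t + (m + 1) + 3 / 2) ^ 3))
      - q (m + 1)
      - (2 * (m + 1) - 1) ^ 2 * (2 * (m + 1)) ^ 2 * p (m + 1 + 1) *
        (((2 * t + m + 1) * (t + m + 1) * (t + m + 3 / 2) ^ 3) /
          ((m + 1) * (2 * t + m + 2) * (t - m) * (t + 2 * m + 1) * (t + 2 * m + 2)))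
      + s (m + 1) (t + 1) *
        (((2 * t + (m + 1) + 3) * (t + 1 / 2) ^ 3 * (t + 1) * (t + 2 * (m + 1) + 1)) /
          ((2 * t + (m + 1) + 1) * (t - (m + 1) + 1) * (t + (m + 1) + 1) * (t + (m + 1) + 3 / 2) ^ 3))
      + s (m + 1) t) * M = 0 := by
    rw [add_mul, add_mul, sub_mul, sub_mul, hT1, hT3, hT4, hT5, hMdef]
    linear_combination hcl
  exact (mul_eq_zero.1 key).resolve_right hM

/-- A half-integer is not an integer: `k + ½ - j ≠ 0`. [folklore] -/
private theorem half_sub_ne_zero (k j : ℕ) : (k : ℚ) + 1 / 2 - j ≠ 0 := by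
  intro h
  have h2 : (2 * k + 1 : ℚ) = 2 * j := by linarith
  have h3 : 2 * k + 1 = 2 * j := by exact_mod_cast h2
  omega

/-- The blocks' denominator is positive at `t = k + ½`. [folklore] -/
private theorem fd_half_pos (n k : ℕ) : 0 < ∏ j ∈ range (n + 1), ((k : ℚ) + 1 / 2 + j + 1 / 2) :=
  prod_pos fun j _ => by positivity

/-- **Identity (21) at the half-integers** `t = k + ½` (all `k ≥ 0`, `n ≥ 1`): here every denominator of the
printed verification is nonzero, so (21) follows from `lemma2_cleared` and the three ratios.
[cite: Zudilin2003Catalan, Sect. 2, Lemma 2, eq. (21)] -/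
theorem identity21_half (n : ℕ) (hn : 1 ≤ n) (k : ℕ) :
    (2 * (n : ℚ) + 1) ^ 2 * (2 * (n : ℚ) + 2) ^ 2 * p (n : ℚ) * R (n + 1) ((k : ℚ) + 1 / 2)
      - q (n : ℚ) * R n ((k : ℚ) + 1 / 2)
      - (2 * (n : ℚ) - 1) ^ 2 * (2 * (n : ℚ)) ^ 2 * p ((n : ℚ) + 1) * R (n - 1) ((k : ℚ) + 1 / 2)
      + s n ((k : ℚ) + 1 / 2 + 1) * R n ((k : ℚ) + 1 / 2 + 1)
      + s n ((k : ℚ) + 1 / 2) * R n ((k : ℚ) + 1 / 2) = 0 := by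
  obtain ⟨m, rfl⟩ : ∃ m, n = m + 1 := ⟨n - 1, by omega⟩
  simp only [Nat.add_sub_cancel]
  set t : ℚ := (k : ℚ) + 1 / 2 with ht
  have hk : (0 : ℚ) ≤ k := Nat.cast_nonneg k
  have hm : (0 : ℚ) ≤ m := Nat.cast_nonneg m
  have htm : t - m ≠ 0 := half_sub_ne_zero k m
  have htm' : t - (m + 1) + 1 ≠ 0 := by rw [show t - (m + 1) + 1 = t - m by ring]; exact htm
  -- the ratios
  have hdn : ∏ j ∈ range (m + 1 + 1), (t + j + 1 / 2) ≠ 0 := (fd_half_pos (m + 1) k).ne'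
  have hdm : ∏ j ∈ range (m + 1), (t + j + 1 / 2) ≠ 0 := (fd_half_pos m k).ne'
  have h1 := R_succ_mul (m + 1) t hdn (by positivity)
  have h2 := R_succ_mul m t hdm (by positivity)
  have h3 := R_shift_mul (m + 1) t hdn (by positivity)
  push_cast at h1 h2 h3 ⊢
  have hA : (2 * t + (m + 1) + 1) * (t + (m + 1) + 1) * (t + (m + 1) + 3 / 2) ^ 3 ≠ 0 := by positivity
  have hB : ((m : ℚ) + 1) * (2 * t + m + 2) * (t - m) * (t + 2 * m + 1) * (t + 2 * m + 2) ≠ 0 := by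
    have : (0 : ℚ) < ((m : ℚ) + 1) * (2 * t + m + 2) := by positivity
    have : (0 : ℚ) < (t + 2 * m + 1) * (t + 2 * m + 2) := by positivity
    intro h0
    rcases mul_eq_zero.1 h0 with h0 | h0
    · rcases mul_eq_zero.1 h0 with h0 | h0
      · rcases mul_eq_zero.1 h0 with h0 | h0
        · linarith
        · exact htm h0
      · have : (0:ℚ) < t + 2 * m + 1 := by positivity
        linarith
    · have : (0:ℚ) < t + 2 * m + 2 := by positivity
      linarith
  have hC : (2 * t + (m + 1) + 1) * (t - (m + 1) + 1) * (t + (m + 1) + 1) * (t + (m + 1) + 3 / 2) ^ 3 ≠ 0 := by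
    refine mul_ne_zero (mul_ne_zero (mul_ne_zero (by positivity) htm') (by positivity)) (by positivity)
  have hS1 : 2 * (2 * (t + 1) + (m + 1) + 1) * (t + 1 + 2 * (m + 1) - 1) * (t + 1 + 2 * (m + 1)) ≠ 0 := by
    have e : t + 1 + 2 * (m + 1) - 1 = t + 2 * m + 2 := by ring
    rw [e]; positivity
  have hS0 : 2 * (2 * t + (m + 1) + 1) * (t + 2 * (m + 1) - 1) * (t + 2 * (m + 1)) ≠ 0 := by
    have e : t + 2 * (m + 1) - 1 = t + 2 * m + 1 := by ring
    rw [e]; positivity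
  have hM : 8 * ((m : ℚ) + 1) * (2 * t + (m + 1) + 1) * (t + (m + 1) + 1) * (2 * t + 2 * (m + 1) + 3) ^ 3 *
      (t - (m + 1) + 1) * (t + 2 * (m + 1) - 1) * (t + 2 * (m + 1)) ≠ 0 := by
    have e : t + 2 * (m + 1) - 1 = t + 2 * m + 1 := by ring
    rw [e]
    exact mul_ne_zero (mul_ne_zero (mul_ne_zero (by positivity) htm') (by positivity)) (by positivity)
  have hX := div21 (m : ℚ) t hA hB hC hS1 hS0 hM
  -- express the three shifted `R`'s through `R_n(t)`
  have e1 : R (m + 1 + 1) t = R (m + 1) t *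
      (((m + 1 + 1) * (2 * t + (m + 1) + 2) * (t - (m + 1)) * (t + 2 * (m + 1) + 1) * (t + 2 * (m + 1) + 2)) /
        ((2 * t + (m + 1) + 1) * (t + (m + 1) + 1) * (t + (m + 1) + 3 / 2) ^ 3)) := by
    rw [mul_div_assoc', eq_div_iff hA]
    linear_combination h1
  have e2 : R m t = R (m + 1) t *
      (((2 * t + m + 1) * (t + m + 1) * (t + m + 3 / 2) ^ 3) /
        ((m + 1) * (2 * t + m + 2) * (t - m) * (t + 2 * m + 1) * (t + 2 * m + 2))) := by
    rw [mul_div_assoc', eq_div_iff hB]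
    linear_combination h2.symm
  have e3 : R (m + 1) (t + 1) = R (m + 1) t *
      (((2 * t + (m + 1) + 3) * (t + 1 / 2) ^ 3 * (t + 1) * (t + 2 * (m + 1) + 1)) /
        ((2 * t + (m + 1) + 1) * (t - (m + 1) + 1) * (t + (m + 1) + 1) * (t + (m + 1) + 3 / 2) ^ 3)) := by
    rw [mul_div_assoc', eq_div_iff hC]
    linear_combination h3
  rw [e1, e2, e3]
  linear_combination R (m + 1) t * hX

/-! ### The partial fractions of the certificate `S_n = s_n R_n` -/

/-- The numerator of the certificate `s_n` (eq. (20)) as a polynomial in `t` for fixed `n`.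
[cite: Zudilin2003Catalan, Sect. 2, eq. (20)] -/
def sNumPoly (n : ℕ) : ℚ[X] :=
  C (8 * (n : ℚ) * (2 * (n : ℚ) - 1) ^ 2 * (20 * (n : ℚ) ^ 2 + 32 * n + 13)) * X ^ 4
    + C (2 * (5440 * (n : ℚ) ^ 6 + 7104 * (n : ℚ) ^ 5 + 912 * (n : ℚ) ^ 4 - 1088 * (n : ℚ) ^ 3
        + 76 * (n : ℚ) ^ 2 + 68 * n + 7)) * X ^ 3
    + C (44800 * (n : ℚ) ^ 7 + 65600 * (n : ℚ) ^ 6 + 17568 * (n : ℚ) ^ 5 - 7056 * (n : ℚ) ^ 4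
        - 1088 * (n : ℚ) ^ 3 + 372 * (n : ℚ) ^ 2 + 146 * n - 1) * X ^ 2
    + C ((2 * (n : ℚ) + 1) * (34880 * (n : ℚ) ^ 7 + 39328 * (n : ℚ) ^ 6 - 2176 * (n : ℚ) ^ 5
        - 8416 * (n : ℚ) ^ 4 + 964 * (n : ℚ) ^ 3 + 154 * (n : ℚ) ^ 2 + 58 * n - 13)) * X
    + C ((n : ℚ) * (2 * (n : ℚ) - 1) * (2 * (n : ℚ) + 1) ^ 2 * (4720 * (n : ℚ) ^ 5 + 6192 * (n : ℚ) ^ 4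
        + 816 * (n : ℚ) ^ 3 - 864 * (n : ℚ) ^ 2 + 69 * n + 13))

/-- `sNumPoly` evaluates to `sNum`. [cite: Zudilin2003Catalan, Sect. 2, eq. (20)] -/
theorem eval_sNumPoly (n : ℕ) (t : ℚ) : (sNumPoly n).eval t = sNum (n : ℚ) t := by
  simp only [sNumPoly, sNum, eval_add, eval_mul, eval_C, eval_pow, eval_X]

/-- `deg sNumPoly ≤ 4`. [cite: Zudilin2003Catalan, Sect. 2, eq. (20)] -/
theorem natDegree_sNumPoly_le (n : ℕ) : (sNumPoly n).natDegree ≤ 4 := by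
  unfold sNumPoly
  refine natDegree_add_le_of_degree_le (natDegree_add_le_of_degree_le (natDegree_add_le_of_degree_le
    (natDegree_add_le_of_degree_le (natDegree_C_mul_X_pow_le _ _) ?_) ?_) ?_) ?_
  · exact (natDegree_C_mul_X_pow_le _ _).trans (by norm_num)
  · exact (natDegree_C_mul_X_pow_le _ _).trans (by norm_num)
  · exact ((natDegree_C_mul_le _ _).trans natDegree_X_le).trans (by norm_num)
  · rw [natDegree_C]
    norm_num

/-- The reduced numerator of `S_n = s_n R_n`: the polynomial `sNum_n(t')·∏_{s<n-1}(t'+n+1+s)/(t'+2n-1)` (for `n ≥ 2`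
the division removes one factor of the product; for `n = 1` it uses `sNum_1(t') = 13(t'+1)(40t'³+1886t'²+7371t'+7578)`).
[cite: Zudilin2003Catalan, Sect. 2, eq. (20) and Lemma 2] -/
def sRed : ℕ → ℚ[X]
  | 0 => 0
  | 1 => C 13 * (C 40 * X ^ 3 + C 1886 * X ^ 2 + C 7371 * X + C 7578)
  | (m + 2) => sNumPoly (m + 2) * ∏ j ∈ range m, (X + C ((m : ℚ) + 3 + j))

/-- Defining property of `sRed`: `sRed_{m+1}(t')·(t'+2m+1) = sNum_{m+1}(t')·∏_{s<m}(t'+m+2+s)`.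
[cite: Zudilin2003Catalan, Sect. 2, eq. (20)] -/
theorem sRed_spec (m : ℕ) (t' : ℚ) :
    (sRed (m + 1)).eval t' * (t' + 2 * m + 1) = sNum ((m : ℚ) + 1) t' * ∏ j ∈ range m, (t' + m + 2 + j) := by
  rcases m with _ | m
  · simp only [sRed, sNum, eval_add, eval_mul, eval_C, eval_pow, eval_X, prod_range_zero]
    push_cast
    ring
  · simp only [sRed, eval_mul, eval_prod, eval_add, eval_X, eval_C, eval_sNumPoly, prod_range_succ]
    push_cast
    have e : ∏ x ∈ range m, (t' + ((m : ℚ) + 3 + x)) = ∏ x ∈ range m, (t' + ((m : ℚ) + 1) + 2 + x) :=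
      prod_congr rfl fun x _ => by ring
    rw [e]
    ring

/-- `deg sRed_n ≤ n + 2`. [cite: Zudilin2003Catalan, Sect. 2, eq. (20)] -/
theorem natDegree_sRed_le : ∀ n : ℕ, (sRed n).natDegree ≤ n + 2
  | 0 => by simp [sRed]
  | 1 => by
    simp only [sRed]
    refine natDegree_mul_le.trans ?_
    rw [natDegree_C, zero_add]
    exact natDegree_cubic_le.trans (by norm_num)
  | (m + 2) => by
    simp only [sRed]
    refine natDegree_mul_le.trans ?_
    have h1 := natDegree_sNumPoly_le (m + 2)
    have h2 : (∏ j ∈ range m, (X + C ((m : ℚ) + 3 + j))).natDegree ≤ m := by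
      refine (natDegree_prod_le _ _).trans ?_
      refine (sum_le_sum fun j _ => (natDegree_X_add_C _).le).trans ?_
      simp
    omega

/-- `Ŝ_n(t) := (n!/2)·sRed_n(t+½)·∏_{j<n}(t+½-j)`: the numerator of `S_n(t+½) = s_n(t+½)R_n(t+½)` over `((t+1)_{n+1})³`.
[cite: Zudilin2003Catalan, Sect. 2, eq. (20) and Lemma 2] -/
def sHat (n : ℕ) : ℚ[X] :=
  C ((n.factorial : ℚ) / 2) * (sRed n).comp (X + C (1 / 2)) * ∏ j ∈ range n, (X + C (1 / 2 - (j : ℚ)))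

/-- Evaluation of `Ŝ_n`. [cite: Zudilin2003Catalan, Sect. 2, eq. (20)] -/
theorem eval_sHat (n : ℕ) (t : ℚ) :
    (sHat n).eval t = (n.factorial : ℚ) / 2 * (sRed n).eval (t + 1 / 2) * ∏ j ∈ range n, (t + (1 / 2 - (j : ℚ))) := by
  simp only [sHat, eval_mul, eval_C, eval_comp, eval_add, eval_X, eval_prod]

/-- `deg Ŝ_n < 3(n+1)`. [cite: Zudilin2003Catalan, Sect. 2, eq. (20)] -/
theorem degree_sHat_lt (n : ℕ) : (sHat n).degree < ((3 * (n + 1) : ℕ) : WithBot ℕ) := by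
  have h1 : (sHat n).natDegree ≤ 2 * n + 2 := by
    unfold sHat
    refine natDegree_mul_le.trans ?_
    have ha : (C ((n.factorial : ℚ) / 2) * (sRed n).comp (X + C (1 / 2))).natDegree ≤ n + 2 := by
      refine natDegree_mul_le.trans ?_
      rw [natDegree_C, zero_add, natDegree_comp, natDegree_X_add_C, mul_one]
      exact natDegree_sRed_le n
    have hb : (∏ j ∈ range n, (X + C (1 / 2 - (j : ℚ)))).natDegree ≤ n := by
      refine (natDegree_prod_le _ _).trans ?_
      refine (sum_le_sum fun j _ => (natDegree_X_add_C _).le).trans ?_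
      simp
    omega
  have h2 : (sHat n).degree ≤ ((2 * n + 2 : ℕ) : WithBot ℕ) := degree_le_of_natDegree_le h1
  have h3 : ((2 * n + 2 : ℕ) : WithBot ℕ) < ((3 * (n + 1) : ℕ) : WithBot ℕ) := by
    exact_mod_cast (show 2 * n + 2 < 3 * (n + 1) by omega)
  exact h2.trans_lt h3

/-- **`Ŝ_n/((t+1)_{n+1})³ = S_n(t+½)`** for `t + ½ ≥ 0` (where no factor of the certificate's denominator vanishes).
[cite: Zudilin2003Catalan, Sect. 2, eq. (20) and Lemma 2] -/
theorem sHat_spec (n : ℕ) (hn : 1 ≤ n) (t : ℚ) (ht : 0 ≤ t + 1 / 2) :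
    (sHat n).eval t / BallRivoal.poch (t + 1) (n + 1) ^ 3 = s n (t + 1 / 2) * R n (t + 1 / 2) := by
  obtain ⟨m, rfl⟩ : ∃ m, n = m + 1 := ⟨n - 1, by omega⟩
  have hm : (0 : ℚ) ≤ m := Nat.cast_nonneg m
  have hD : (0 : ℚ) < BallRivoal.poch (t + 1) (m + 1 + 1) := by
    unfold BallRivoal.poch
    exact prod_pos fun j _ => by have := (Nat.cast_nonneg j : (0 : ℚ) ≤ j); linarith
  have hD3 : BallRivoal.poch (t + 1) (m + 1 + 1) ^ 3 ≠ 0 := pow_ne_zero 3 hD.ne'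
  have hW : 2 * (2 * (t + 1 / 2) + ((m + 1 : ℕ) : ℚ) + 1) * (t + 1 / 2 + 2 * ((m + 1 : ℕ) : ℚ) - 1) *
      (t + 1 / 2 + 2 * ((m + 1 : ℕ) : ℚ)) ≠ 0 := by
    push_cast
    have e : t + 1 / 2 + 2 * ((m : ℚ) + 1) - 1 = t + 1 / 2 + 2 * m + 1 := by ring
    rw [e]
    positivity
  have hspec := sRed_spec m (t + 1 / 2)
  have hP : BallRivoal.poch (t + (((m + 1 : ℕ) : ℚ) + 3 / 2)) (m + 1) =
      (∏ j ∈ range m, (t + 1 / 2 + m + 2 + j)) * (t + 1 / 2 + 2 * (m + 1)) := by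
    rw [BallRivoal.poch, prod_range_succ]
    push_cast
    congr 1
    · exact prod_congr rfl fun j _ => by ring
    · ring
  rw [s, R_half_shift, eval_sHat, eval_numPoly, hP, div_mul_div_comm,
    div_eq_div_iff hD3 (mul_ne_zero hW hD3)]
  push_cast
  linear_combination ((m + 1).factorial : ℚ) * (∏ j ∈ range (m + 1), (t + (1 / 2 - (j : ℚ)))) *
    (2 * (t + 1 / 2) + (m + 1) + 1) * (t + 1 / 2 + 2 * (m + 1)) *
    BallRivoal.poch (t + 1) (m + 1 + 1) ^ 3 * hspec

/-- Partial-fraction data of `S_n(t+½)` (orders `≤ 3`, poles `t = -i-1`, `i ≤ n`). [cite: Zudilin2003Catalan, Sect. 2, proof of Lemma 4] -/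
theorem exists_pfS (n : ℕ) : ∃ d : ℕ → ℕ → ℚ, ∀ t : ℚ, (∀ i, i ≤ n → t + i + 1 ≠ 0) →
    pfEval n 3 d t = (sHat n).eval t / BallRivoal.poch (t + 1) (n + 1) ^ 3 :=
  exists_partialFractions n 3 (by norm_num) (sHat n) (degree_sHat_lt n)

/-- THE partial-fraction data of `S_n` (chosen). [cite: Zudilin2003Catalan, Sect. 2, proof of Lemma 4] -/
def pfS (n : ℕ) : ℕ → ℕ → ℚ := (exists_pfS n).choose

/-- Defining property of `pfS`. [cite: Zudilin2003Catalan, Sect. 2, proof of Lemma 4] -/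
theorem pfS_spec (n : ℕ) (t : ℚ) (ht : ∀ i, i ≤ n → t + i + 1 ≠ 0) :
    pfEval n 3 (pfS n) t = (sHat n).eval t / BallRivoal.poch (t + 1) (n + 1) ^ 3 :=
  (exists_pfS n).choose_spec t ht

/-- `pfEval (pfS n) t = S_n(t+½) = s_n(t+½) R_n(t+½)` for `t + ½ ≥ 0` away from the poles.
[cite: Zudilin2003Catalan, Sect. 2, proof of Lemma 4] -/
theorem pfS_eval (n : ℕ) (hn : 1 ≤ n) (t : ℚ) (ht : 0 ≤ t + 1 / 2) (hp : ∀ i, i ≤ n → t + i + 1 ≠ 0) :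
    pfEval n 3 (pfS n) t = s n (t + 1 / 2) * R n (t + 1 / 2) := by
  rw [pfS_spec n t hp, sHat_spec n hn t ht]

/-! ### The identity (21) at the level of partial-fraction data; Lemma 4 -/

/-- Data on poles `i ≤ m` extended by zero to more poles (bookkeeping for "the formulae (15) remain true for all `k`").
[cite: Zudilin2003Catalan, Sect. 2, proof of Lemma 4] -/
def padData (m : ℕ) (c : ℕ → ℕ → ℚ) : ℕ → ℕ → ℚ := fun o i => if i ≤ m then c o i else 0

/-- Padding does not change the evaluation. [cite: Zudilin2003Catalan, Sect. 2, proof of Lemma 4] -/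
theorem pfEval_padData (N m K : ℕ) (h : m ≤ N) (c : ℕ → ℕ → ℚ) (t : ℚ) :
    pfEval N K (padData m c) t = pfEval m K c t := by
  unfold pfEval padData
  rw [← sum_subset (Finset.range_subset_range.2 (by omega : m + 1 ≤ N + 1))]
  · exact sum_congr rfl fun i hi => by
      have : i ≤ m := Nat.lt_succ_iff.1 (mem_range.1 hi)
      simp [this]
  · intro i _ hi
    have : ¬ i ≤ m := fun h' => hi (mem_range.2 (Nat.lt_succ_of_le h'))
    simp [this]

/-- Weighted coefficient sums are unchanged by padding. [cite: Zudilin2003Catalan, Sect. 2, proof of Lemma 4] -/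
theorem sum_padData (N m : ℕ) (h : m ≤ N) (w : ℕ → ℚ) (c : ℕ → ℕ → ℚ) (o : ℕ) :
    ∑ i ∈ range (N + 1), w i * padData m c o i = ∑ i ∈ range (m + 1), w i * c o i := by
  unfold padData
  rw [← sum_subset (Finset.range_subset_range.2 (by omega : m + 1 ≤ N + 1))]
  · exact sum_congr rfl fun i hi => by
      have : i ≤ m := Nat.lt_succ_iff.1 (mem_range.1 hi)
      simp [this]
  · intro i _ hi
    have : ¬ i ≤ m := fun h' => hi (mem_range.2 (Nat.lt_succ_of_le h'))
    simp [this]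

/-- Data shifted by one pole: the data of `t ↦ F(t+1)` (the `S_n(t+1)` term of (21)). [cite: Zudilin2003Catalan, Sect. 2, proof of Lemma 4] -/
def shiftData (c : ℕ → ℕ → ℚ) : ℕ → ℕ → ℚ := fun o i => if i = 0 then 0 else c o (i - 1)

/-- `pfEval (shiftData c) t = pfEval c (t+1)`. [cite: Zudilin2003Catalan, Sect. 2, proof of Lemma 4] -/
theorem pfEval_shiftData (m K : ℕ) (c : ℕ → ℕ → ℚ) (t : ℚ) :
    pfEval (m + 1) K (shiftData c) t = pfEval m K c (t + 1) := by
  unfold pfEval shiftData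
  rw [sum_range_succ']
  simp only [Nat.succ_ne_zero, if_false, if_true, zero_div, sum_const_zero, add_zero,
    Nat.add_sub_cancel]
  refine sum_congr rfl fun i _ => sum_congr rfl fun o _ => ?_
  push_cast
  ring

/-- Alternating coefficient sums flip sign under the shift (so those of `S_n(t+1) + S_n(t)` vanish: the heart of Lemma 4).
[cite: Zudilin2003Catalan, Sect. 2, proof of Lemma 4] -/
theorem sum_shiftData (m : ℕ) (c : ℕ → ℕ → ℚ) (o : ℕ) :
    ∑ i ∈ range (m + 2), (-1 : ℚ) ^ i * shiftData c o i = -∑ i ∈ range (m + 1), (-1 : ℚ) ^ i * c o i := by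
  unfold shiftData
  rw [sum_range_succ', ← sum_neg_distrib]
  simp only [Nat.succ_ne_zero, if_false, if_true, mul_zero, add_zero, Nat.add_sub_cancel, pow_succ]
  exact sum_congr rfl fun i _ => by ring

/-- The datum of `c₊ R_{n+1}(t) - q(n) R_n(t) - c₋ R_{n-1}(t) + S_n(t+1) + S_n(t)` (shifted variable; `n = m+1`,
poles `i ≤ n+1`). [cite: Zudilin2003Catalan, Sect. 2, proof of Lemma 4] -/
def comb (m : ℕ) : ℕ → ℕ → ℚ := fun o i =>
  (2 * ((m : ℚ) + 1) + 1) ^ 2 * (2 * ((m : ℚ) + 1) + 2) ^ 2 * p ((m : ℚ) + 1) * pf (m + 2) o i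
    - q ((m : ℚ) + 1) * padData (m + 1) (pf (m + 1)) o i
    - (2 * ((m : ℚ) + 1) - 1) ^ 2 * (2 * ((m : ℚ) + 1)) ^ 2 * p ((m : ℚ) + 1 + 1) * padData m (pf m) o i
    + shiftData (pfS (m + 1)) o i + padData (m + 1) (pfS (m + 1)) o i

/-- Evaluation of `comb m`. [cite: Zudilin2003Catalan, Sect. 2, proof of Lemma 4] -/
theorem pfEval_comb (m : ℕ) (t : ℚ) :
    pfEval (m + 2) 3 (comb m) t =
      (2 * ((m : ℚ) + 1) + 1) ^ 2 * (2 * ((m : ℚ) + 1) + 2) ^ 2 * p ((m : ℚ) + 1) * pfEval (m + 2) 3 (pf (m + 2)) t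
        - q ((m : ℚ) + 1) * pfEval (m + 1) 3 (pf (m + 1)) t
        - (2 * ((m : ℚ) + 1) - 1) ^ 2 * (2 * ((m : ℚ) + 1)) ^ 2 * p ((m : ℚ) + 1 + 1) * pfEval m 3 (pf m) t
        + pfEval (m + 1) 3 (pfS (m + 1)) (t + 1) + pfEval (m + 1) 3 (pfS (m + 1)) t := by
  rw [← pfEval_padData (m + 2) (m + 1) 3 (by omega) (pf (m + 1)) t,
    ← pfEval_padData (m + 2) m 3 (by omega) (pf m) t, ← pfEval_shiftData (m + 1) 3 (pfS (m + 1)) t,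
    ← pfEval_padData (m + 2) (m + 1) 3 (by omega) (pfS (m + 1)) t]
  unfold pfEval comb
  simp only [add_div, sub_div, sum_add_distrib, sum_sub_distrib, mul_sum, mul_div_assoc]

/-- At `t = k` (i.e. `t' = k + ½`) the datum `comb m` evaluates to the left minus the right side of (21), which is
zero by `identity21_half`. [cite: Zudilin2003Catalan, Sect. 2, proof of Lemma 4] -/
theorem pfEval_comb_nat (m k : ℕ) : pfEval (m + 2) 3 (comb m) (k : ℚ) = 0 := by
  have h := identity21_half (m + 1) (by omega) k
  push_cast at h
  rw [pfEval_comb, pf_spec_nat, pf_spec_nat, pf_spec_nat,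
    pfS_eval (m + 1) (by omega) ((k : ℚ) + 1) (by positivity) (fun i _ => by positivity),
    pfS_eval (m + 1) (by omega) (k : ℚ) (by positivity) (fun i _ => by positivity)]
  push_cast
  rw [show (k : ℚ) + 1 + 1 / 2 = (k : ℚ) + 1 / 2 + 1 by ring]
  linear_combination h

/-- **The identity (21) at the level of data**: every coefficient of `comb m` vanishes (uniqueness of partial
fractions, `BallRivoal.pf_unique`, from the vanishing at all naturals). [cite: Zudilin2003Catalan, Sect. 2, proof of Lemma 4] -/
theorem comb_eq_zero (m o i : ℕ) (ho : o < 3) (hi : i ≤ m + 2) : comb m o i = 0 :=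
  pf_unique (m + 2) 3 (comb m) 0 (fun k _ => pfEval_comb_nat m k) o i ho hi

/-- **(21) at the naturals** `t' = k` (by evaluating the vanishing datum at `t = k - ½`), for `n = m+1`:
`c₊ R_{n+1}(k) - q(n) R_n(k) - c₋ R_{n-1}(k) = -S_n(k+1) - S_n(k)`. [cite: Zudilin2003Catalan, Sect. 2, Lemma 2, eq. (21)] -/
theorem identity21_nat (m k : ℕ) :
    (2 * ((m : ℚ) + 1) + 1) ^ 2 * (2 * ((m : ℚ) + 1) + 2) ^ 2 * p ((m : ℚ) + 1) * R (m + 2) k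
      - q ((m : ℚ) + 1) * R (m + 1) k
      - (2 * ((m : ℚ) + 1) - 1) ^ 2 * (2 * ((m : ℚ) + 1)) ^ 2 * p ((m : ℚ) + 1 + 1) * R m k
      + s ((m : ℚ) + 1) ((k : ℚ) + 1) * R (m + 1) ((k : ℚ) + 1) + s ((m : ℚ) + 1) k * R (m + 1) k = 0 := by
  have h0 : pfEval (m + 2) 3 (comb m) ((k : ℚ) - 1 / 2) = 0 := by
    unfold pfEval
    exact sum_eq_zero fun i hi => sum_eq_zero fun o ho => by
      rw [comb_eq_zero m o i (mem_range.1 ho) (Nat.lt_succ_iff.1 (mem_range.1 hi)), zero_div]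
  have hp : ∀ n : ℕ, ∀ i, i ≤ n → (k : ℚ) - 1 / 2 + i + 1 ≠ 0 := fun n i _ => by
    have := (Nat.cast_nonneg k : (0 : ℚ) ≤ k); have := (Nat.cast_nonneg i : (0 : ℚ) ≤ i)
    intro h; linarith
  rw [pfEval_comb, pf_spec _ _ (hp _), pf_spec _ _ (hp _), pf_spec _ _ (hp _),
    pfS_eval (m + 1) (by omega) ((k : ℚ) - 1 / 2 + 1) (by
      have := (Nat.cast_nonneg k : (0 : ℚ) ≤ k); linarith) (fun i _ => by
      have := (Nat.cast_nonneg k : (0 : ℚ) ≤ k); have := (Nat.cast_nonneg i : (0 : ℚ) ≤ i)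
      intro h; linarith),
    pfS_eval (m + 1) (by omega) ((k : ℚ) - 1 / 2) (by
      have := (Nat.cast_nonneg k : (0 : ℚ) ≤ k); linarith) (hp _),
    sub_add_cancel, show (k : ℚ) - 1 / 2 + 1 + 1 / 2 = (k : ℚ) + 1 by ring] at h0
  push_cast at h0 ⊢
  linear_combination h0

/-- **Lemma 4**: the alternating coefficient sums `n ↦ coefAlt n o` (`o = 0, 1, 2`, i.e. `U_n''/2, U_n'/4, U_n/8`)
satisfy the difference equation (2). [cite: Zudilin2003Catalan, Sect. 2, Lemma 4] -/
theorem coefAlt_isSolution (o : ℕ) (ho : o < 3) : IsSolution (fun n => coefAlt n o) := by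
  intro n hn
  obtain ⟨m, rfl⟩ : ∃ m, n = m + 1 := ⟨n - 1, by omega⟩
  simp only [Nat.add_sub_cancel, show m + 1 + 1 = m + 2 by omega]
  push_cast
  -- alternating sum of the vanishing datum
  have h0 : ∑ i ∈ range (m + 3), (-1 : ℚ) ^ i * comb m o i = 0 :=
    sum_eq_zero fun i hi => by rw [comb_eq_zero m o i ho (Nat.lt_succ_iff.1 (mem_range.1 hi)), mul_zero]
  have e1 : ∑ i ∈ range (m + 3), (-1 : ℚ) ^ i * comb m o i =
      (2 * ((m : ℚ) + 1) + 1) ^ 2 * (2 * ((m : ℚ) + 1) + 2) ^ 2 * p ((m : ℚ) + 1) *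
          ∑ i ∈ range (m + 3), (-1 : ℚ) ^ i * pf (m + 2) o i
        - q ((m : ℚ) + 1) * ∑ i ∈ range (m + 3), (-1 : ℚ) ^ i * padData (m + 1) (pf (m + 1)) o i
        - (2 * ((m : ℚ) + 1) - 1) ^ 2 * (2 * ((m : ℚ) + 1)) ^ 2 * p ((m : ℚ) + 1 + 1) *
          ∑ i ∈ range (m + 3), (-1 : ℚ) ^ i * padData m (pf m) o i
        + ∑ i ∈ range (m + 3), (-1 : ℚ) ^ i * shiftData (pfS (m + 1)) o i
        + ∑ i ∈ range (m + 3), (-1 : ℚ) ^ i * padData (m + 1) (pfS (m + 1)) o i := by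
    simp only [comb, mul_add, mul_sub, sum_add_distrib, sum_sub_distrib, mul_sum]
    refine congrArg₂ _ (congrArg₂ _ (congrArg₂ _ (congrArg₂ _ ?_ ?_) ?_) rfl) rfl
    · exact sum_congr rfl fun i _ => by ring
    · exact sum_congr rfl fun i _ => by ring
    · exact sum_congr rfl fun i _ => by ring
  rw [e1, sum_padData (m + 2) (m + 1) (by omega), sum_padData (m + 2) m (by omega),
    sum_padData (m + 2) (m + 1) (by omega),
    show m + 3 = (m + 1) + 2 by omega, sum_shiftData (m + 1) (pfS (m + 1)) o] at h0
  unfold coefAlt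
  linear_combination h0

/-! ### Initial values: the partial fractions of `R_0` and `R_1` (display before Lemma 5) -/

/-- The data of `R_0(t') = 2/(t'+½)²`. [cite: Zudilin2003Catalan, Sect. 2, display before Lemma 5] -/
def tab0 : ℕ → ℕ → ℚ := fun o i => if o = 1 ∧ i = 0 then 2 else 0

/-- `tab0` evaluates to `R_0`. [cite: Zudilin2003Catalan, Sect. 2, display before Lemma 5] -/
theorem tab0_eval (k : ℕ) : pfEval 0 3 tab0 (k : ℚ) = R 0 ((k : ℚ) + 1 / 2) := by
  have hk : (0 : ℚ) < (k : ℚ) + 1 := by positivity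
  simp only [pfEval, tab0, R, sum_range_succ, sum_range_zero, prod_range_zero, Nat.factorial_zero]
  norm_num
  field_simp
  ring

/-- `pf 0 = tab0` on the support. [cite: Zudilin2003Catalan, Sect. 2, display before Lemma 5] -/
theorem pf_zero (o i : ℕ) (ho : o < 3) (hi : i ≤ 0) : pf 0 o i = tab0 o i :=
  (pf_eq_of_eval 0 tab0 tab0_eval o i ho hi).symm

/-- The data of `R_1(t') = -(3/4)/(t'+½)³ - (3/4)/(t'+3/2)³ + (7/4)/(t'+½)² - (7/4)/(t'+3/2)²`.
[cite: Zudilin2003Catalan, Sect. 2, display before Lemma 5] -/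
def tab1 : ℕ → ℕ → ℚ := fun o i =>
  if o = 2 then -3 / 4 else if o = 1 then (if i = 0 then 7 / 4 else -7 / 4) else 0

/-- `tab1` evaluates to `R_1`. [cite: Zudilin2003Catalan, Sect. 2, display before Lemma 5] -/
theorem tab1_eval (k : ℕ) : pfEval 1 3 tab1 (k : ℚ) = R 1 ((k : ℚ) + 1 / 2) := by
  have hk : (0 : ℚ) < (k : ℚ) + 1 := by positivity
  have hk2 : (0 : ℚ) < (k : ℚ) + 2 := by positivity
  simp only [pfEval, tab1, R, sum_range_succ, sum_range_zero, prod_range_succ, prod_range_zero,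
    Nat.factorial_one]
  norm_num
  field_simp
  ring

/-- `pf 1 = tab1` on the support. [cite: Zudilin2003Catalan, Sect. 2, display before Lemma 5] -/
theorem pf_one (o i : ℕ) (ho : o < 3) (hi : i ≤ 1) : pf 1 o i = tab1 o i :=
  (pf_eq_of_eval 1 tab1 tab1_eval o i ho hi).symm

/-- `(U_0'', U_0'/2, U_0/…)`: `coefAlt 0 = (0, 2, 0)`, i.e. `U_0' = 8`, `U_0 = U_0'' = 0`.
[cite: Zudilin2003Catalan, Sect. 2, display before Lemma 5] -/
theorem coefAlt_zero_values : coefAlt 0 0 = 0 ∧ coefAlt 0 1 = 2 ∧ coefAlt 0 2 = 0 := by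
  simp only [coefAlt, sum_range_succ, sum_range_zero, pf_zero _ _ (by norm_num : (0:ℕ) < 3) le_rfl,
    pf_zero _ _ (by norm_num : (1:ℕ) < 3) le_rfl, pf_zero _ _ (by norm_num : (2:ℕ) < 3) le_rfl, tab0]
  norm_num

/-- `coefAlt 1 = (0, 7/2, 0)`, i.e. `U_1' = 14`, `U_1 = U_1'' = 0`. [cite: Zudilin2003Catalan, Sect. 2, display before Lemma 5] -/
theorem coefAlt_one_values : coefAlt 1 0 = 0 ∧ coefAlt 1 1 = 7 / 2 ∧ coefAlt 1 2 = 0 := by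
  have h : ∀ o, o < 3 → ∀ i, i ≤ 1 → pf 1 o i = tab1 o i := fun o ho i hi => pf_one o i ho hi
  simp only [coefAlt, sum_range_succ, sum_range_zero, h 0 (by norm_num) 0 (by norm_num),
    h 0 (by norm_num) 1 le_rfl, h 1 (by norm_num) 0 (by norm_num), h 1 (by norm_num) 1 le_rfl,
    h 2 (by norm_num) 0 (by norm_num), h 2 (by norm_num) 1 le_rfl, tab1]
  norm_num

/-- `V_0 = 0` and `V_1 = 13` (so `v_0 = 0`, `v_1 = 13/8`, the initial data (4)).
[cite: Zudilin2003Catalan, Sect. 2, display before Lemma 5] -/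
theorem V_init : V 0 = 0 ∧ V 1 = 13 := by
  have h : ∀ o, o < 3 → ∀ i, i ≤ 1 → pf 1 o i = tab1 o i := fun o ho i hi => pf_one o i ho hi
  constructor
  · simp [V, harmAlt]
  · simp only [V, harmAlt, sum_range_succ, sum_range_zero, h 0 (by norm_num) 0 (by norm_num),
      h 0 (by norm_num) 1 le_rfl, h 1 (by norm_num) 0 (by norm_num), h 1 (by norm_num) 1 le_rfl,
      h 2 (by norm_num) 0 (by norm_num), h 2 (by norm_num) 1 le_rfl, tab1]
    norm_num

/-- **`U_n = U_n'' = 0` for all `n`** (Lemma 4 and the initial values). [cite: Zudilin2003Catalan, Sect. 2, before Lemma 5] -/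
theorem coefAlt_eq_zero (n : ℕ) : coefAlt n 0 = 0 ∧ coefAlt n 2 = 0 := by
  have hz : IsSolution (fun _ => (0 : ℚ)) := fun n _ => by ring
  have h0 := IsSolution.ext_of_init (coefAlt_isSolution 0 (by norm_num)) hz
    coefAlt_zero_values.1 coefAlt_one_values.1
  have h2 := IsSolution.ext_of_init (coefAlt_isSolution 2 (by norm_num)) hz
    coefAlt_zero_values.2.2 coefAlt_one_values.2.2
  exact ⟨congrFun h0 n, congrFun h2 n⟩

/-- **`U_n' = 8 u_n`**, i.e. `coefAlt n 1 = 2 u_n` (Lemma 4, initial values (4)). [cite: Zudilin2003Catalan, Sect. 2, Lemma 5] -/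
theorem coefAlt_one_eq (n : ℕ) : coefAlt n 1 = 2 * u n := by
  have hy : IsSolution (fun n => coefAlt n 1 / 2) := by
    intro n hn
    have h := coefAlt_isSolution 1 (by norm_num) n hn
    linear_combination h / 2
  have hu : IsSolution u := sol_isSolution 1 (7 / 4)
  have h := IsSolution.ext_of_init hy hu (by simp [coefAlt_zero_values.2.1, u])
    (by rw [coefAlt_one_values.2.1, u, sol_one]; norm_num)
  have := congrFun h n
  linear_combination 2 * this

/-- `U_n = 0`, `U_n'' = 0`, `U_n' = 8 u_n`. [cite: Zudilin2003Catalan, Sect. 2, Lemma 5] -/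
theorem U_values (n : ℕ) : U3 n = 0 ∧ U1 n = 0 ∧ U2 n = 8 * u n := by
  refine ⟨?_, ?_, ?_⟩
  · rw [U3, (coefAlt_eq_zero n).2, mul_zero]
  · rw [U1, (coefAlt_eq_zero n).1, mul_zero]
  · rw [U2, coefAlt_one_eq]; ring

/-! ### The size of `R_n(t)` at the naturals -/

/-- `R_n(N) = 0` for naturals `N < n` (the factor `t(t-1)⋯(t-n+1)`). [cite: Zudilin2003Catalan, Sect. 2, proof of Lemma 3] -/
theorem R_nat_eq_zero (n N : ℕ) (h : N < n) : R n (N : ℚ) = 0 := by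
  unfold R
  rw [prod_eq_zero (mem_range.2 h) (sub_self (N : ℚ))]
  simp

/-- **Elementary bound** (ours; it replaces the role of the source's Theorem 3 / [Be] asymptotics in the proof of the
limit relation): `0 ≤ R_n(N) ≤ 2^{n+1}/(N+½)²` for naturals `N ≥ n` (termwise comparison of the numerator with
`∏_{j<n}(N+j+½)`). [cite: Zudilin2003Catalan, Sect. 2, proof of Theorem 1 (limit relation); estimate not in the source] -/
theorem R_nat_bounds (n N : ℕ) (h : n ≤ N) :
    0 ≤ R n (N : ℚ) ∧ R n (N : ℚ) ≤ 2 ^ (n + 1) / ((N : ℚ) + 1 / 2) ^ 2 := by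
  have hN : (n : ℚ) ≤ N := by exact_mod_cast h
  set P1 : ℚ := ∏ j ∈ range n, ((N : ℚ) + j + 1 / 2) with hP1
  have hP1pos : 0 < P1 := prod_pos fun j _ => by positivity
  have hA0 : 0 ≤ ∏ j ∈ range n, ((N : ℚ) - j) :=
    prod_nonneg fun j hj => by
      have : (j : ℚ) < n := by exact_mod_cast mem_range.1 hj
      linarith
  have hA : ∏ j ∈ range n, ((N : ℚ) - j) ≤ P1 :=
    prod_le_prod (fun j hj => by
      have : (j : ℚ) < n := by exact_mod_cast mem_range.1 hj
      linarith) fun j _ => by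
      have := (Nat.cast_nonneg j : (0 : ℚ) ≤ j); linarith
  have hB0 : 0 ≤ ∏ j ∈ range n, ((N : ℚ) + n + 1 + j) := prod_nonneg fun j _ => by positivity
  have hB : ∏ j ∈ range n, ((N : ℚ) + n + 1 + j) ≤ 2 ^ n * P1 := by
    have e : (2 : ℚ) ^ n * P1 = ∏ j ∈ range n, (2 * ((N : ℚ) + j + 1 / 2)) := by
      rw [prod_mul_distrib, prod_const, card_range]
    rw [e]
    exact prod_le_prod (fun j _ => by positivity) fun j _ => by
      have := (Nat.cast_nonneg j : (0 : ℚ) ≤ j); linarith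
  have hF : (n.factorial : ℚ) ≤ P1 := by
    rw [hP1, ← prod_range_add_one_eq_factorial, Nat.cast_prod]
    exact prod_le_prod (fun j _ => by positivity) fun j hj => by
      have : 1 ≤ N := by have := mem_range.1 hj; omega
      have : (1 : ℚ) ≤ N := by exact_mod_cast this
      push_cast
      linarith
  have hD : ∏ j ∈ range (n + 1), ((N : ℚ) + j + 1 / 2) = P1 * ((N : ℚ) + n + 1 / 2) := by
    rw [prod_range_succ]
  have hDpos : 0 < ((N : ℚ) + n + 1 / 2) := by positivity
  have hD3 : 0 < (P1 * ((N : ℚ) + n + 1 / 2)) ^ 3 := pow_pos (mul_pos hP1pos hDpos) 3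
  constructor
  · unfold R
    rw [hD]
    exact div_nonneg (mul_nonneg (mul_nonneg (by positivity) hA0) hB0) hD3.le
  · unfold R
    rw [hD, div_le_div_iff₀ hD3 (by positivity)]
    -- numerator · (N+½)² ≤ 2^{n+1} · (P1 (N+n+½))³
    have h1 : (n.factorial : ℚ) * (2 * N + n + 1) * (∏ j ∈ range n, ((N : ℚ) - j)) *
        (∏ j ∈ range n, ((N : ℚ) + n + 1 + j)) ≤ P1 * (2 * ((N : ℚ) + n + 1 / 2)) * P1 * (2 ^ n * P1) := by
      gcongr
      · linarith
    have h2 : ((N : ℚ) + 1 / 2) ^ 2 ≤ ((N : ℚ) + n + 1 / 2) ^ 2 := by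
      gcongr; linarith
    calc (n.factorial : ℚ) * (2 * N + n + 1) * (∏ j ∈ range n, ((N : ℚ) - j)) *
          (∏ j ∈ range n, ((N : ℚ) + n + 1 + j)) * ((N : ℚ) + 1 / 2) ^ 2
        ≤ P1 * (2 * ((N : ℚ) + n + 1 / 2)) * P1 * (2 ^ n * P1) * ((N : ℚ) + n + 1 / 2) ^ 2 :=
          mul_le_mul h1 h2 (by positivity) (by positivity)
      _ = 2 ^ (n + 1) * (P1 * ((N : ℚ) + n + 1 / 2)) ^ 3 := by ring

/-- `|R_n(N)| ≤ 2^{n+1}/(N+½)²` for every natural `N` (ours, see `R_nat_bounds`).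
[cite: Zudilin2003Catalan, Sect. 2, proof of Theorem 1 (limit relation); estimate not in the source] -/
theorem abs_R_nat_le (n N : ℕ) : |R n (N : ℚ)| ≤ 2 ^ (n + 1) / ((N : ℚ) + 1 / 2) ^ 2 := by
  rcases lt_or_ge N n with h | h
  · rw [R_nat_eq_zero n N h, abs_zero]; positivity
  · obtain ⟨h0, h1⟩ := R_nat_bounds n N h
    rwa [abs_of_nonneg h0]

/-- The comparison series `∑ 1/(N+½)²` converges. [folklore] -/
private theorem summable_inv_half_sq : Summable (fun N : ℕ => 1 / ((N : ℝ) + 1 / 2) ^ 2) := by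
  have := summable_alt_half 2 le_rfl
  refine (this.norm).congr fun N => ?_
  rw [norm_div, norm_pow, norm_neg, norm_one, one_pow, norm_pow, Real.norm_eq_abs,
    abs_of_pos (by positivity)]

/-- **`|F_n| ≤ 2^{n+1} · ∑_N 1/(N+½)²`** (ours, from `abs_R_nat_le`; the source uses Theorem 3 instead).
[cite: Zudilin2003Catalan, Sect. 2, proof of Theorem 1 (limit relation); estimate not in the source] -/
theorem abs_F_le (n : ℕ) : |F n| ≤ 2 ^ (n + 1) * ∑' N : ℕ, 1 / ((N : ℝ) + 1 / 2) ^ 2 := by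
  have hg : HasSum (fun N : ℕ => (2 : ℝ) ^ (n + 1) * (1 / ((N : ℝ) + 1 / 2) ^ 2))
      (2 ^ (n + 1) * ∑' N : ℕ, 1 / ((N : ℝ) + 1 / 2) ^ 2) :=
    summable_inv_half_sq.hasSum.mul_left _
  have h := tsum_of_norm_bounded hg (f := fun t : ℕ => (-1 : ℝ) ^ t * (R n t : ℝ)) fun N => by
    rw [norm_mul, norm_pow, norm_neg, norm_one, one_pow, one_mul, Real.norm_eq_abs]
    have := abs_R_nat_le n N
    have h' : |(R n (N : ℚ) : ℝ)| ≤ ((2 ^ (n + 1) / ((N : ℚ) + 1 / 2) ^ 2 : ℚ) : ℝ) := by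
      rw [← Rat.cast_abs]; exact_mod_cast this
    refine h'.trans (le_of_eq ?_)
    push_cast
    ring
  rw [Real.norm_eq_abs] at h
  exact h

/-! ### `S_n(N) → 0` and Lemma 3 -/

/-- A crude polynomial bound: `|sNum_n(t)| ≤ K_n t⁴` for `t ≥ 1`, with `K_n` the sum of the absolute values of the
five coefficients of (20). [folklore] -/
private theorem abs_sNum_le (n t : ℚ) (ht : 1 ≤ t) :
    |sNum n t| ≤ (|8 * n * (2 * n - 1) ^ 2 * (20 * n ^ 2 + 32 * n + 13)|
      + |2 * (5440 * n ^ 6 + 7104 * n ^ 5 + 912 * n ^ 4 - 1088 * n ^ 3 + 76 * n ^ 2 + 68 * n + 7)|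
      + |44800 * n ^ 7 + 65600 * n ^ 6 + 17568 * n ^ 5 - 7056 * n ^ 4 - 1088 * n ^ 3 + 372 * n ^ 2
          + 146 * n - 1|
      + |(2 * n + 1) * (34880 * n ^ 7 + 39328 * n ^ 6 - 2176 * n ^ 5 - 8416 * n ^ 4 + 964 * n ^ 3
          + 154 * n ^ 2 + 58 * n - 13)|
      + |n * (2 * n - 1) * (2 * n + 1) ^ 2 * (4720 * n ^ 5 + 6192 * n ^ 4 + 816 * n ^ 3 - 864 * n ^ 2
          + 69 * n + 13)|) * t ^ 4 := by
  set c4 := 8 * n * (2 * n - 1) ^ 2 * (20 * n ^ 2 + 32 * n + 13)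
  set c3 := 2 * (5440 * n ^ 6 + 7104 * n ^ 5 + 912 * n ^ 4 - 1088 * n ^ 3 + 76 * n ^ 2 + 68 * n + 7)
  set c2 := 44800 * n ^ 7 + 65600 * n ^ 6 + 17568 * n ^ 5 - 7056 * n ^ 4 - 1088 * n ^ 3 + 372 * n ^ 2
    + 146 * n - 1
  set c1 := (2 * n + 1) * (34880 * n ^ 7 + 39328 * n ^ 6 - 2176 * n ^ 5 - 8416 * n ^ 4 + 964 * n ^ 3
    + 154 * n ^ 2 + 58 * n - 13)
  set c0 := n * (2 * n - 1) * (2 * n + 1) ^ 2 * (4720 * n ^ 5 + 6192 * n ^ 4 + 816 * n ^ 3 - 864 * n ^ 2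
    + 69 * n + 13)
  have hs : sNum n t = c4 * t ^ 4 + c3 * t ^ 3 + c2 * t ^ 2 + c1 * t + c0 := by
    simp only [sNum, c4, c3, c2, c1, c0]
  have ht0 : 0 ≤ t := by linarith
  have h4 : |c4 * t ^ 4| = |c4| * t ^ 4 := by rw [abs_mul, abs_of_nonneg (pow_nonneg ht0 4)]
  have h3 : |c3 * t ^ 3| ≤ |c3| * t ^ 4 := by
    rw [abs_mul, abs_of_nonneg (pow_nonneg ht0 3)]
    exact mul_le_mul_of_nonneg_left (pow_le_pow_right₀ ht (by norm_num)) (abs_nonneg _)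
  have h2 : |c2 * t ^ 2| ≤ |c2| * t ^ 4 := by
    rw [abs_mul, abs_of_nonneg (pow_nonneg ht0 2)]
    exact mul_le_mul_of_nonneg_left (pow_le_pow_right₀ ht (by norm_num)) (abs_nonneg _)
  have h1 : |c1 * t| ≤ |c1| * t ^ 4 := by
    rw [abs_mul, abs_of_nonneg ht0]
    exact mul_le_mul_of_nonneg_left (le_self_pow₀ ht (by norm_num)) (abs_nonneg _)
  have h0 : |c0| ≤ |c0| * t ^ 4 :=
    le_mul_of_one_le_right (abs_nonneg _) (one_le_pow₀ ht)
  rw [hs]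
  calc |c4 * t ^ 4 + c3 * t ^ 3 + c2 * t ^ 2 + c1 * t + c0|
      ≤ |c4 * t ^ 4| + |c3 * t ^ 3| + |c2 * t ^ 2| + |c1 * t| + |c0| := by
        refine (abs_add_le _ _).trans (add_le_add ((abs_add_le _ _).trans (add_le_add ((abs_add_le _ _).trans
          (add_le_add ((abs_add_le _ _).trans le_rfl) le_rfl)) le_rfl)) le_rfl)
    _ ≤ |c4| * t ^ 4 + |c3| * t ^ 4 + |c2| * t ^ 4 + |c1| * t ^ 4 + |c0| * t ^ 4 := by
        rw [h4]; gcongr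
    _ = (|c4| + |c3| + |c2| + |c1| + |c0|) * t ^ 4 := by ring

/-- **`S_n(N) = s_n(N) R_n(N) → 0`** as `N → ∞` (`n ≥ 1`): `|s_n(N)| = O(N)` against `R_n(N) = O(N^{-2})`.
[cite: Zudilin2003Catalan, Sect. 2, proof of Lemma 3] -/
theorem tendsto_S (n : ℕ) (hn : 1 ≤ n) :
    Tendsto (fun N : ℕ => ((s (n : ℚ) N * R n N : ℚ) : ℝ)) atTop (𝓝 0) := by
  obtain ⟨K, hK⟩ : ∃ K : ℚ, 0 ≤ K ∧ ∀ t : ℚ, 1 ≤ t → |sNum (n : ℚ) t| ≤ K * t ^ 4 :=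
    ⟨_, by positivity, fun t ht => abs_sNum_le (n : ℚ) t ht⟩
  -- eventually |S_n(N)| ≤ K 2^{n+1} / N
  have hb : ∀ N : ℕ, 1 ≤ N → |((s (n : ℚ) N * R n N : ℚ) : ℝ)| ≤ ((K * 2 ^ (n + 1) : ℚ) : ℝ) / (N : ℝ) := by
    intro N hN
    have hN' : (1 : ℚ) ≤ N := by exact_mod_cast hN
    have hn' : (1 : ℚ) ≤ n := by exact_mod_cast hn
    have hden : 4 * (N : ℚ) ^ 3 ≤ 2 * (2 * (N : ℚ) + n + 1) * ((N : ℚ) + 2 * n - 1) * ((N : ℚ) + 2 * n) := by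
      have e : 2 * (2 * (N : ℚ) + n + 1) * ((N : ℚ) + 2 * n - 1) * ((N : ℚ) + 2 * n) - 4 * (N : ℚ) ^ 3 =
          (18 * (n : ℚ) - 2) * (N : ℚ) ^ 2 + (24 * (n : ℚ) ^ 2 - 2 * n - 2) * N
            + (8 * (n : ℚ) ^ 3 + 4 * (n : ℚ) ^ 2 - 4 * n) := by ring
      have c1 : 0 ≤ (18 * (n : ℚ) - 2) * (N : ℚ) ^ 2 := mul_nonneg (by linarith) (sq_nonneg _)
      have c2 : 0 ≤ (24 * (n : ℚ) ^ 2 - 2 * n - 2) * N := mul_nonneg (by nlinarith) (by linarith)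
      have c3 : 0 ≤ 8 * (n : ℚ) ^ 3 + 4 * (n : ℚ) ^ 2 - 4 * n := by nlinarith
      linarith
    have hdenpos : 0 < 2 * (2 * (N : ℚ) + n + 1) * ((N : ℚ) + 2 * n - 1) * ((N : ℚ) + 2 * n) :=
      lt_of_lt_of_le (by positivity) hden
    have hs : |s (n : ℚ) N| ≤ K * N / 4 := by
      rw [s, abs_div, abs_of_pos hdenpos, div_le_iff₀ hdenpos]
      calc |sNum (n : ℚ) N| ≤ K * (N : ℚ) ^ 4 := hK.2 _ hN'
        _ = K * N / 4 * (4 * (N : ℚ) ^ 3) := by ring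
        _ ≤ K * N / 4 * (2 * (2 * (N : ℚ) + n + 1) * ((N : ℚ) + 2 * n - 1) * ((N : ℚ) + 2 * n)) :=
          mul_le_mul_of_nonneg_left hden (div_nonneg (mul_nonneg hK.1 (by positivity)) (by norm_num))
    have hR : |R n (N : ℚ)| ≤ 2 ^ (n + 1) / (N : ℚ) ^ 2 :=
      (abs_R_nat_le n N).trans (div_le_div_of_nonneg_left (by positivity) (pow_pos (by linarith) 2)
        (by gcongr; linarith))
    have hq : |s (n : ℚ) N * R n N| ≤ K * 2 ^ (n + 1) / N := by
      rw [abs_mul]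
      calc |s (n : ℚ) N| * |R n (N : ℚ)| ≤ (K * N / 4) * (2 ^ (n + 1) / (N : ℚ) ^ 2) :=
            mul_le_mul hs hR (abs_nonneg _) (div_nonneg (mul_nonneg hK.1 (by positivity)) (by norm_num))
        _ = K * 2 ^ (n + 1) / N / 4 := by field_simp
        _ ≤ K * 2 ^ (n + 1) / N :=
          div_le_self (div_nonneg (mul_nonneg hK.1 (by positivity)) (by positivity)) (by norm_num)
    have := (Rat.cast_le (K := ℝ)).2 hq
    push_cast at this ⊢
    exact this
  have hlim : Tendsto (fun N : ℕ => ((K * 2 ^ (n + 1) : ℚ) : ℝ) / (N : ℝ)) atTop (𝓝 0) :=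
    tendsto_const_div_atTop_nhds_zero_nat _
  refine squeeze_zero_norm' ?_ hlim
  filter_upwards [eventually_ge_atTop 1] with N hN
  rw [Real.norm_eq_abs]
  exact hb N hN

/-- `F_n` is the sum of its defining series. [cite: Zudilin2003Catalan, Sect. 2, eq. (8)] -/
theorem hasSum_F' (n : ℕ) : HasSum (fun t : ℕ => (-1 : ℝ) ^ t * (R n t : ℝ)) (F n) :=
  (hasSum_F n).summable.hasSum

/-- **Lemma 3**: `F_n` satisfies the difference equation (2) for `n ≥ 1` (written with `n = m+1`): multiply (21)
by `(-1)^t` and sum over `t ≥ 0`; the right-hand side telescopes to `S_n(0) - lim (-1)^N S_n(N) = 0`.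
[cite: Zudilin2003Catalan, Sect. 2, Lemma 3] -/
theorem F_rec (m : ℕ) :
    (2 * ((m : ℝ) + 1) + 1) ^ 2 * (2 * ((m : ℝ) + 1) + 2) ^ 2 * ((p ((m : ℚ) + 1) : ℚ) : ℝ) * F (m + 2)
      - ((q ((m : ℚ) + 1) : ℚ) : ℝ) * F (m + 1)
      - (2 * ((m : ℝ) + 1) - 1) ^ 2 * (2 * ((m : ℝ) + 1)) ^ 2 * ((p ((m : ℚ) + 1 + 1) : ℚ) : ℝ) * F m = 0 := by
  set cp : ℝ := (2 * ((m : ℝ) + 1) + 1) ^ 2 * (2 * ((m : ℝ) + 1) + 2) ^ 2 * ((p ((m : ℚ) + 1) : ℚ) : ℝ)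
    with hcp
  set cq : ℝ := ((q ((m : ℚ) + 1) : ℚ) : ℝ) with hcq
  set cm : ℝ := (2 * ((m : ℝ) + 1) - 1) ^ 2 * (2 * ((m : ℝ) + 1)) ^ 2 * ((p ((m : ℚ) + 1 + 1) : ℚ) : ℝ)
    with hcm
  -- the series of the left-hand side of (21) against (-1)^t
  have hΛ : HasSum (fun N : ℕ => cp * ((-1 : ℝ) ^ N * (R (m + 2) N : ℝ)) - cq * ((-1 : ℝ) ^ N * (R (m + 1) N : ℝ))
      - cm * ((-1 : ℝ) ^ N * (R m N : ℝ))) (cp * F (m + 2) - cq * F (m + 1) - cm * F m) :=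
    (((hasSum_F' (m + 2)).mul_left cp).sub ((hasSum_F' (m + 1)).mul_left cq)).sub ((hasSum_F' m).mul_left cm)
  -- termwise it is a telescoping difference
  set b : ℕ → ℝ := fun N => (-1 : ℝ) ^ N * ((s ((m : ℚ) + 1) N * R (m + 1) N : ℚ) : ℝ) with hb
  have hterm : ∀ N : ℕ, cp * ((-1 : ℝ) ^ N * (R (m + 2) N : ℝ)) - cq * ((-1 : ℝ) ^ N * (R (m + 1) N : ℝ))
      - cm * ((-1 : ℝ) ^ N * (R m N : ℝ)) = b (N + 1) - b N := by
    intro N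
    have h := congrArg (fun x : ℚ => (x : ℝ)) (identity21_nat m N)
    simp only [hb, hcp, hcq, hcm, pow_succ]
    push_cast at h ⊢
    linear_combination (-1 : ℝ) ^ N * h
  have hb0 : b 0 = 0 := by
    have h0 : R (m + 1) ((0 : ℕ) : ℚ) = 0 := R_nat_eq_zero (m + 1) 0 (by omega)
    simp only [hb, pow_zero, h0, mul_zero, Rat.cast_zero]
  have hpart : ∀ M : ℕ, ∑ N ∈ range M, (cp * ((-1 : ℝ) ^ N * (R (m + 2) N : ℝ))
      - cq * ((-1 : ℝ) ^ N * (R (m + 1) N : ℝ)) - cm * ((-1 : ℝ) ^ N * (R m N : ℝ))) = b M := by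
    intro M
    rw [sum_congr rfl fun N _ => hterm N, Finset.sum_range_sub, hb0, sub_zero]
  have hbt : Tendsto b atTop (𝓝 0) := by
    have h := tendsto_S (m + 1) (by omega)
    refine squeeze_zero_norm' (Eventually.of_forall fun N => ?_) (h.norm.trans (by simp))
    simp only [hb, norm_mul, norm_pow, norm_neg, norm_one, one_pow, one_mul]
    push_cast
    exact le_rfl
  have h1 := hΛ.tendsto_sum_nat
  simp_rw [hpart] at h1
  exact tendsto_nhds_unique h1 hbt

/-- **`V_n` satisfies (2)** (Lemma 4, last clause: `V_n = U_n' β(2) + … - F_n` and each term does).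
[cite: Zudilin2003Catalan, Sect. 2, Lemma 4] -/
theorem V_isSolution : IsSolution V := by
  intro n hn
  obtain ⟨m, rfl⟩ : ∃ m, n = m + 1 := ⟨n - 1, by omega⟩
  simp only [Nat.add_sub_cancel, show m + 1 + 1 = m + 2 by omega]
  -- over ℝ: V_k = 8 u_k G - F_k
  have hV : ∀ k : ℕ, (V k : ℝ) = 8 * (u k : ℝ) * catalanConstant - F k := by
    intro k
    have h := F_eq k
    obtain ⟨h3, h1, h2⟩ := U_values k
    rw [h3, h1, h2, beta_two] at h
    push_cast at h
    linarith
  have hu := sol_isSolution 1 (7 / 4) (m + 1) (by omega)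
  simp only [Nat.add_sub_cancel, show m + 1 + 1 = m + 2 by omega] at hu
  have hu' := congrArg (fun x : ℚ => (x : ℝ)) hu
  have hF := F_rec m
  have key : (((2 * ((m + 1 : ℕ) : ℚ) + 1) ^ 2 * (2 * ((m + 1 : ℕ) : ℚ) + 2) ^ 2 * p ((m + 1 : ℕ) : ℚ) * V (m + 2)
      - q ((m + 1 : ℕ) : ℚ) * V (m + 1)
      - (2 * ((m + 1 : ℕ) : ℚ) - 1) ^ 2 * (2 * ((m + 1 : ℕ) : ℚ)) ^ 2 * p (((m + 1 : ℕ) : ℚ) + 1) * V m : ℚ) : ℝ)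
      = 0 := by
    push_cast at hu' ⊢
    rw [hV, hV, hV]
    simp only [u] at hu' ⊢
    linear_combination (8 * catalanConstant) * hu' - hF
  exact_mod_cast key

/-- **`V_n = 8 v_n`** (same recursion, `V_0 = 0 = 8v_0`, `V_1 = 13 = 8v_1`). [cite: Zudilin2003Catalan, Sect. 2, Lemma 5] -/
theorem V_eq (n : ℕ) : V n = 8 * v n := by
  have h8 : IsSolution (fun n => 8 * v n) := by
    intro n hn
    have h := sol_isSolution 0 (13 / 8) n hn
    simp only [v]
    linear_combination 8 * h
  have h := IsSolution.ext_of_init V_isSolution h8 (by rw [V_init.1, v, sol_zero]; norm_num)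
    (by rw [V_init.2, v, sol_one]; norm_num)
  exact congrFun h n

/-- **Lemma 5**: `F_n = U_n' G - V_n = 8(u_n G - v_n)` — the very-well-poised series (8) IS the linear form of
Theorem 1 (times 8). [cite: Zudilin2003Catalan, Sect. 2, Lemma 5] -/
theorem F_eq_form (n : ℕ) : F n = 8 * form n := by
  have h := F_eq n
  obtain ⟨h3, h1, h2⟩ := U_values n
  rw [h3, h1, h2, beta_two, V_eq] at h
  rw [h, form]
  push_cast
  ring

/-- The hypergeometric representation of the linear forms as a series:
`u_n G - v_n = (1/8) ∑_{t≥0} (-1)^t R_n(t)`. [cite: Zudilin2003Catalan, Sect. 2, Lemma 5 with eq. (8)] -/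
theorem hasSum_form (n : ℕ) : HasSum (fun t : ℕ => (-1 : ℝ) ^ t * (R n t : ℝ) / 8) (form n) := by
  have h := (hasSum_F' n).div_const 8
  rwa [F_eq_form, mul_div_cancel_left₀ _ (by norm_num : (8 : ℝ) ≠ 0)] at h

/-! ### The limit clause of Theorem 1: `v_n/u_n → G` -/

/-- `q(n) ≥ 5·(2n+1)²(2n+2)²p(n)` for `n ≥ 1` (all coefficients of the difference are positive after `n = m+1`).
[cite: Zudilin2003Catalan, Sect. 1, eqs. (2)–(3)] -/
theorem five_mul_lead_le_q (m : ℕ) :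
    5 * ((2 * ((m : ℚ) + 1) + 1) ^ 2 * (2 * ((m : ℚ) + 1) + 2) ^ 2 * p ((m : ℚ) + 1)) ≤ q ((m : ℚ) + 1) := by
  have hm : (0 : ℚ) ≤ m := Nat.cast_nonneg m
  have e : q ((m : ℚ) + 1) - 5 * ((2 * ((m : ℚ) + 1) + 1) ^ 2 * (2 * ((m : ℚ) + 1) + 2) ^ 2 * p ((m : ℚ) + 1)) =
      1920 * (m : ℚ) ^ 6 + 12992 * (m : ℚ) ^ 5 + 34864 * (m : ℚ) ^ 4 + 46992 * (m : ℚ) ^ 3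
        + 33056 * (m : ℚ) ^ 2 + 11208 * m + 1339 := by
    unfold q p; ring
  have : (0 : ℚ) ≤ 1920 * (m : ℚ) ^ 6 + 12992 * (m : ℚ) ^ 5 + 34864 * (m : ℚ) ^ 4 + 46992 * (m : ℚ) ^ 3
      + 33056 * (m : ℚ) ^ 2 + 11208 * m + 1339 := by positivity
  linarith

/-- **Growth of `u_n`**: `u_{n+1} ≥ 5 u_n` for `n ≥ 1` (from (2): `c₊u_{n+1} = q u_n + c₋u_{n-1} ≥ q u_n ≥ 5c₊u_n`).
[cite: Zudilin2003Catalan, Sect. 1, eqs. (2)–(4)] -/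
theorem u_succ_ge (m : ℕ) : 5 * u (m + 1) ≤ u (m + 2) := by
  have h := sol_isSolution 1 (7 / 4) (m + 1) (by omega)
  simp only [Nat.add_sub_cancel, show m + 1 + 1 = m + 2 by omega] at h
  push_cast at h
  have hq := five_mul_lead_le_q m
  have hu0 : 0 < u m := (u_pos_and_v_succ_pos m).1
  have hu1 : 0 < u (m + 1) := (u_pos_and_v_succ_pos (m + 1)).1
  have hp1 : 0 < p ((m : ℚ) + 1) := p_pos _
  have hp2 : 0 < p ((m : ℚ) + 1 + 1) := p_pos _
  have hm : (0 : ℚ) ≤ m := Nat.cast_nonneg m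
  have hc : 0 < (2 * ((m : ℚ) + 1) + 1) ^ 2 * (2 * ((m : ℚ) + 1) + 2) ^ 2 * p ((m : ℚ) + 1) := by positivity
  have hcm : 0 ≤ (2 * ((m : ℚ) + 1) - 1) ^ 2 * (2 * ((m : ℚ) + 1)) ^ 2 * p ((m : ℚ) + 1 + 1) * u m := by
    positivity
  -- c₊ u_{m+2} = q u_{m+1} + c₋ u_m ≥ 5 c₊ u_{m+1}
  simp only [u] at *
  nlinarith [mul_le_mul_of_nonneg_right hq hu1.le]

/-- `u_n ≥ (7/4)·5^{n-1}` for `n ≥ 1`. [cite: Zudilin2003Catalan, Sect. 1, eqs. (2)–(4)] -/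
theorem u_lower (m : ℕ) : (7 / 4 : ℚ) * 5 ^ m ≤ u (m + 1) := by
  induction m with
  | zero => simp [u]
  | succ m ih =>
    have := u_succ_ge m
    rw [pow_succ]
    linarith

/-- **Theorem 1, limit clause (PROVED)**: `v_n/u_n → G`. The source uses Theorem 3 (Beukers-type integral) for
`F_n → 0`; here: `|u_n G - v_n| = |F_n|/8 ≤ 2^{n-2}·∑_N (N+½)^{-2}` (`abs_F_le`) against `u_n ≥ (7/4)5^{n-1}`.
[cite: Zudilin2003Catalan, Theorem 1 (limit relation)] -/
theorem tendsto_v_div_u :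
    Tendsto (fun n : ℕ => ((v n / u n : ℚ) : ℝ)) atTop (𝓝 catalanConstant) := by
  set T : ℝ := ∑' N : ℕ, 1 / ((N : ℝ) + 1 / 2) ^ 2 with hT
  have hT0 : 0 ≤ T := tsum_nonneg fun N => by positivity
  -- |v_n/u_n - G| ≤ (T/7)·5·(2/5)^n for n ≥ 1
  have hbound : ∀ m : ℕ, |((v (m + 1) / u (m + 1) : ℚ) : ℝ) - catalanConstant| ≤ T * (5 / 7) * (2 / 5) ^ (m + 1) := by
    intro m
    have hu : (7 / 4 : ℚ) * 5 ^ m ≤ u (m + 1) := u_lower m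
    have hupos : (0 : ℚ) < u (m + 1) := (u_pos_and_v_succ_pos (m + 1)).1
    have hupos' : (0 : ℝ) < (u (m + 1) : ℝ) := by exact_mod_cast hupos
    have hu' : (7 / 4 : ℝ) * 5 ^ m ≤ (u (m + 1) : ℝ) := by
      have := (Rat.cast_le (K := ℝ)).2 hu
      push_cast at this
      exact this
    have hF : |F (m + 1)| ≤ 2 ^ (m + 1 + 1) * T := abs_F_le (m + 1)
    have hform : |form (m + 1)| ≤ 2 ^ m * T / 2 := by
      have : form (m + 1) = F (m + 1) / 8 := by rw [F_eq_form]; ring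
      rw [this, abs_div, abs_of_pos (by norm_num : (0:ℝ) < 8), div_le_iff₀ (by norm_num : (0:ℝ) < 8)]
      calc |F (m + 1)| ≤ 2 ^ (m + 1 + 1) * T := hF
        _ = 2 ^ m * T / 2 * 8 := by ring
    have hdiff : ((v (m + 1) / u (m + 1) : ℚ) : ℝ) - catalanConstant = -(form (m + 1)) / (u (m + 1) : ℝ) := by
      rw [form]
      push_cast
      field_simp
      ring
    rw [hdiff, abs_div, abs_neg, abs_of_pos hupos', div_le_iff₀ hupos']
    calc |form (m + 1)| ≤ 2 ^ m * T / 2 := hform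
      _ = T * (5 / 7) * (2 / 5) ^ (m + 1) * ((7 / 4 : ℝ) * 5 ^ m) := by
          rw [div_pow, pow_succ, pow_succ]
          field_simp
          ring
      _ ≤ T * (5 / 7) * (2 / 5) ^ (m + 1) * (u (m + 1) : ℝ) := by gcongr
  have hgeom : Tendsto (fun n : ℕ => T * (5 / 7) * (2 / 5 : ℝ) ^ n) atTop (𝓝 0) := by
    have := (tendsto_pow_atTop_nhds_zero_of_lt_one (by norm_num : (0:ℝ) ≤ 2 / 5)
      (by norm_num : (2 / 5 : ℝ) < 1)).const_mul (T * (5 / 7))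
    simpa using this
  rw [← tendsto_sub_nhds_zero_iff]
  refine squeeze_zero_norm' ?_ hgeom
  filter_upwards [eventually_ge_atTop 1] with n hn
  obtain ⟨m, rfl⟩ : ∃ m, n = m + 1 := ⟨n - 1, by omega⟩
  rw [Real.norm_eq_abs]
  exact hbound m

end Literature.NumberTheory.Irrationality.Zudilin2003
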